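import Summits.KontsevichZagierPeriods.KontsevichZagierPeriods.Theses.HurwitzMicroSectors
import Literature.NumberTheory.Transcendental.KZLogCalculusProofs
import Literature.NumberTheory.Transcendental.BoxIntegralHurwitz
import Literature.NumberTheory.Transcendental.BoxCoordinatePowerMap

/-!
# Disproof of `AperySectorThreeTwo` (crux stmt-KontsevichZagierPeriods-3873, route HurwitzMicroSectors) — findings

Standing adversary (refuter-cdisprove-stmt-KontsevichZagierPeriods-3873-0), cycle 1, 2026-08-16;
cycle 2 (gen-2 seat refuter-cdisprove-stmt-KontsevichZagierPeriods-3873-g2-0, 2026-08-16): §8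
TARGETS — every stub of the three registered line skeletons HOLDS (proved verbatim, §8.1–§8.2),
plus a refuted shortening of the polar target (§8.3); verdict unchanged.
Crux (verbatim): for `r r' : KZ.IntegralRep 3` on the open box `(0,1)³` with integrands
`P(t)/(1 − t²)`, `P'(t)/(1 − t²)` (`t = x₀x₁x₂`, `P, P' ∈ ℚ[t]`) and `r.value = r'.value`,
`KZ.Equivalent r r'`.

VERDICT: **the crux is TRUE and PROVED in this file (§7, `Proof.aperySectorThreeTwo`, 0 sorry,
standard axioms; also attached to the item as evidence `AperySectorThreeTwoProofStandalone.lean`)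
— no kill exists.** It is a literal sub-case of the summit (§1, `aperySectorThreeTwo_of_summit`),
every member is `IsRational`, and the route's reduction is sound: all value bookkeeping is in tree
(`BoxIntegral.box_integral_level_two_weight_three_zero/one`, `level_two_weight_three_relation`,
`box_integral_normalForm_weight_three`, `normalForm_weight_three_coeff_eq` — Apéry unconditional)
and all move-level analysis too (`BoxCoordinatePowerMap.lean`). What this file proves (0 `sorry`):

* §0 kit: `ubox` (semialgebraic, measurable, Fubini `setIntegral_pi_prod`), `polyRep Q` = the
  member `[box, Q(t)]` (numerator `P = Q·(1 − X²)`), `value_polyRep_monomial`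
  (`∫ c t^k = c/(k+1)³`).
* §1 SUMMIT-NECESSITY `aperySectorThreeTwo_of_summit : KontsevichZagierPeriods → AperySectorThreeTwo`
  (`isRational_of_sector`): `¬crux → ¬summit`; there is no evaluative refutation channel.
* §2 LOAD-BEARING: `aperySectorThreeTwo_false_without_value` — drop `r.value = r'.value` and
  `[box,0]`, `[box,1]` (values `0 ≠ 1`) refute it by soundness. The two domain clauses and the two
  `EqOn` clauses are SCOPE restrictions, not load-bearing for truth: deleting them yields larger
  sub-cases of Conjecture 1 (for `ℚ`-semialgebraic integrands), unrefutable by value — no theorem.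
* §3 REFUTED STRENGTHENINGS: `not_aperySectorThreeTwoEqOn`, `not_aperySectorThreeTwoInjective` —
  equal values do NOT force equal integrands / numerators: `[box, 1]` and `[box, 8t]`
  (`P = 1 − X²`, `P' = 8X − 8X³`) both have value `1`. Rigidity holds only after reduction.
* §4 LOAD-BEARING MOVES: `aperySectorThreeTwo_needs_rule_two_or_three` — localised evaluation
  `evalOn A` (mass in a test set) kills `closure (domainAddRel ∪ integrandAddRel)`
  (`addOnlyRelations_le_ker_evalOn`) but gives `1/8 ≠ 1/64` on the corner `(0,½)³` for the pair of
  §3: rule (1) alone cannot prove the crux; every chain contains a change of variables or a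
  Newton–Leibniz move.
* §5 NON-VACUITY for every numerator (`sectorRep P`, the typed integrand verbatim, absolutely
  integrable for ALL `P`: `hypotheses_satisfiable`) and the POLAR pair `[box, 1/(1−t²)]`,
  `[box, 7t/(1−t²)]`: equal values `h₀ = 7h₁ = 7ζ(3)/8` (`polar_value_eq`) yet
  `polar_not_mem_addOnlyRelations` (corner mass of `(1 − 7t)/(1 − t²)` is `≥ 1/64`): the
  distribution relation `H₀ ∼ 7H₁` is not an additivity relation — the route's ONE dilation
  (`xᵢ ↦ xᵢ²`, `m = 2`) is unavoidable modulo rule (3).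

* §6 TIGHTNESS of §4–§5 (positive, machine-checked): `dilation_mem_changeOfVariablesRel` (item
  DilationMove at `n = 3`, packaged from the tree's `BoxCoordinatePowerMap.lean`),
  `poly_pair_equivalent : [box,1] ~ [box,8t]` (ONE dilation) and
  `polar_equivalent : [box, 1/(1−t²)] ~ [box, 7t/(1−t²)]` (one dilation + two integrand
  additivities) — the pairs that rule (1) cannot connect ARE connected by rule (2) (+(1b)).

* §7 THE PROOF: `Proof.aperySectorThreeTwo : AperySectorThreeTwo` (see the §7 docblock).

* §8 TARGETS (cycle 2): the registered stubs of lines `flattening-dilation` (active skeleton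
  `2cbf2400…`: `stub_monomialFlatten`, `stub_polarDistribution`, `stub_normalFormReduction`,
  `stub_normalFormRigidity`) and `level-lowering` (`stub_levelTwoToLevelOne`,
  `stub_polynomialCompression`) are TRUE AS TYPED — `Targets.<stub>_holds` carries each registered
  signature verbatim with a ≤ 25-line proof from §6–§7 (no side-condition slip, no vacuity; the
  `dilation-coinvariants` stubs are proved by their planner's evidence file). §8.3: the natural
  SHORTENING "the polar target is ONE `m = 2` dilation" is refuted in both orientations
  (`Targets.polar_not_dilationTwo_pullback/pushforward`, test point `(½,½,½)`): the distribution
  relation needs the (1b) split `c/(1−s) = [c/(1−s²)] + [cs/(1−s²)]` around the dilation.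

NOTES FOR PROVERS (learned while attacking; realised in §7):
* The chain can stay on the open box in dimension 3 and use ONLY integrand additivity (1b) and
  dilations (rule 2): `[box, q·t^k] ∼ [box, q/(k+1)³]` is ONE dilation `xᵢ ↦ xᵢ^{k+1}` applied to
  the constant `q/(k+1)³` (Jacobian `(k+1)³ t^k`), so "Newton–Leibniz thrice to a point and back"
  and the null boundary faces (rule 1a) are unnecessary; the polar part is `[(1+t)/(1−t²)] =
  [1/(1−t)] ∼ [8t/(1−t²)]` (dilation `m = 2` on `1/(1−t)`), then `(1b)` twice. Rational scalars
  ride inside integrands (every move instance is closed under `f ↦ q·f`), so the `ℤ`-span suffices: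
  with `P = Q(1−X²) + α + βX`, `value = Σ q_k/(k+1)³ + (7α + β)·ζ(3)/8`, and equal values ⇔
  `Σ (q_k − q'_k)/(k+1)³ = 0 ∧ 7(α − α') + (β − β') = 0` (Apéry), the second defect being
  `δ·(1 − 7t)/(1 − t²) = δ/(1−t) − 8δt/(1−t²) ∼ 0`.
* Direct Newton–Leibniz on the polar part is obstructed: the `z`-primitive of `1/(1 − (xyz)²)` is
  `artanh(xyz)/(xy)`, transcendental — cf. barrier `noSemialgebraicPrimitive_inv_sub_two` /
  `algebraicPrimitivesObstructionNarrow` (in-class primitive elimination); the dilation evades it.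

OPEN (not claimed): is a change of variables NECESSARY, i.e. is the polar defect outside
`closure (domainAddRel ∪ integrandAddRel ∪ newtonLeibnizRel)`? No NL-compatible invariant other
than `eval` is known to us (an absolutely continuous linear invariant compatible with NL is a
multiple of `eval`; see §4 docstring). Is integrand additivity necessary (CoV + NL generators are
differences, so the augmentation does not obstruct)? Unknown.

BARRIERS (`Literature/Barriers/KontsevichZagierPeriods/`): `kzConjecture_implies_oddZetaAlgIndep`
is cashed, not evaded (the rung's independence input is Apéry, a theorem);
`noSemialgebraicPrimitive_inv_sub_two` obstructs only an NL-first strategy (above);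
`cressonViuSos_prop_3_2` (one global map, no dissection) n/a — though note the chain above needs no
dissection at all; `not_complete_of_undecidable` has no force (value equality on the sector is
decidable: compare `(Σ q_k/(k+1)³, 7α+β)`). `ledger negatives`: 1 entry (KinematicPlaneConvex),
unrelated. Literature search: searchd unavailable throughout this cycle (rc 75, logged); no printed
counterexample to Conjecture 1 exists in any sector, and this one is now a theorem.

LANDED (gate, namespace `Summit.KontsevichZagierPeriods.Theorems.AperySectorThreeTwo.Negative`):
`Theorems/AperySectorThreeTwo/Negative/Kit.lean` (p72852: §0, §1, `sectorRep`, polar values),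
`…/LoadBearing.lean` (p73367: §2, §3), `…/AdditivityOnly.lean` (p73465: §4, §5, §6),
`…/PolarNotOneDilation.lean` (p74705, cycle 2: §8.3) — importable. Literature search in cycle 2:
searchd rc 75 and galaxy 0-row (degraded) at 01:45–01:55Z, logged; nothing new to cite.
EVIDENCE on the item (positive, for a prover to land): `AperySectorThreeTwoProof.lean` (imports the
landed Kit; = §7) and the self-contained `AperySectorThreeTwoProofStandalone.lean`.
-/

noncomputable section

set_option linter.dupNamespace false

open MeasureTheory Set MvPolynomial intervalIntegral
open Literature.NumberTheory.Transcendental Literature.ModelTheory.ExponentialFields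

namespace Summit.KontsevichZagierPeriods.KontsevichZagierPeriods.Cruxes.AperySectorThreeTwo.Disproof

open Summit.KontsevichZagierPeriods.KontsevichZagierPeriods.Theses.HurwitzMicroSectors
  (AperySectorThreeTwo)

/-! ## §0 Witness kit: the open unit box and polynomial-integrand members of the sector -/

/-- The open unit box `(0,1)³`, verbatim as typed in the crux. [folklore] -/
def ubox : Set (Fin 3 → ℝ) := {x | ∀ i, x i ∈ Ioo (0:ℝ) 1}

/-- Auxiliary: `ubox_eq_pi`. [folklore] -/
theorem ubox_eq_pi : ubox = Set.pi univ fun _ => Ioo (0:ℝ) 1 := by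
  ext x; simp [ubox]

/-- Auxiliary: `measurableSet_ubox`. [folklore] -/
theorem measurableSet_ubox : MeasurableSet ubox := by
  rw [ubox_eq_pi]; exact MeasurableSet.univ_pi fun _ => measurableSet_Ioo

/-- Auxiliary: `ubox_subset_Icc`. [folklore] -/
theorem ubox_subset_Icc : ubox ⊆ Icc (0 : Fin 3 → ℝ) 1 :=
  fun _ hx => ⟨fun i => (hx i).1.le, fun i => (hx i).2.le⟩

/-- The open unit box is `ℚ`-semialgebraic. [folklore] -/
theorem isSemialgebraic_ubox : IsSemialgebraic ℚ ubox := by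
  have h : ubox = ⋂ i ∈ (Finset.univ : Finset (Fin 3)),
      ({x : Fin 3 → ℝ | aeval x (C 0 : MvPolynomial (Fin 3) ℚ) < aeval x (X i : MvPolynomial (Fin 3) ℚ)} ∩
       {x : Fin 3 → ℝ | aeval x (X i : MvPolynomial (Fin 3) ℚ) < aeval x (C 1 : MvPolynomial (Fin 3) ℚ)}) := by
    ext x; simp [ubox]
  rw [h]
  exact IsSemialgebraic.biInter _ _ fun i _ =>
    (isSemialgebraic_setOf_eval_lt (k := ℚ) (R := ℝ) _ _).inter
      (isSemialgebraic_setOf_eval_lt (k := ℚ) (R := ℝ) _ _)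

/-- Fubini on a coordinate box for a product integrand. [folklore] -/
theorem setIntegral_pi_prod (s : Fin 3 → Set ℝ) (g : Fin 3 → ℝ → ℝ) :
    ∫ x in Set.pi univ s, ∏ i, g i (x i) = ∏ i, ∫ t in s i, g i t := by
  rw [MeasureTheory.volume_pi, Measure.restrict_pi_pi, integral_fintype_prod_eq_prod]

/-- Auxiliary: `volume_ubox`. [folklore] -/
theorem integral_ubox_one : ∫ _ in ubox, (1 : ℝ) = 1 := by
  have h := setIntegral_pi_prod (fun _ => Ioo (0:ℝ) 1) (fun _ _ => (1 : ℝ))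
  simp only [Finset.prod_const_one] at h
  rw [ubox_eq_pi, h]
  simp

/-- The product coordinate `t = x₀x₁x₂`. [folklore] -/
theorem prod_mem_Ioo {x : Fin 3 → ℝ} (hx : x ∈ ubox) : x 0 * x 1 * x 2 ∈ Ioo (0:ℝ) 1 := by
  have h0 := hx 0; have h1 := hx 1; have h2 := hx 2
  refine ⟨by have := h0.1; have := h1.1; have := h2.1; positivity, ?_⟩
  calc x 0 * x 1 * x 2 < 1 * 1 * 1 := by
        have := mul_lt_mul'' (mul_lt_mul'' h0.2 h1.2 h0.1.le h1.1.le) h2.2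
          (mul_nonneg h0.1.le h1.1.le) h2.1.le
        simpa using this
    _ = 1 := by ring

/-- On the open box the typed denominator `1 − t²` does not vanish. [folklore] -/
theorem one_sub_sq_pos {x : Fin 3 → ℝ} (hx : x ∈ ubox) : 0 < 1 - (x 0 * x 1 * x 2) ^ 2 := by
  have h := prod_mem_Ioo hx
  have : (x 0 * x 1 * x 2) ^ 2 < 1 := by
    have := h.1; have := h.2
    nlinarith
  linarith

/-- The substitution identity `aeval x (P(X₀X₁X₂)) = P(x₀x₁x₂)`. [folklore] -/
theorem aeval_comp_prod (x : Fin 3 → ℝ) (P : Polynomial ℚ) :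
    MvPolynomial.aeval x (Polynomial.aeval (X 0 * X 1 * X 2 : MvPolynomial (Fin 3) ℚ) P) =
      Polynomial.aeval (x 0 * x 1 * x 2) P := by
  rw [← Polynomial.aeval_algHom_apply]
  simp

/-- `[ (0,1)³, Q(x₀x₁x₂) ]`: the member of the sector with numerator `P = Q · (1 − X²)`
(polynomial integrand, bounded, hence absolutely integrable). [folklore] -/
def polyRep (Q : Polynomial ℚ) : KZ.IntegralRep 3 where
  domain := ubox
  integrand x := Polynomial.aeval (x 0 * x 1 * x 2) Q
  isSemialgebraic_domain := isSemialgebraic_ubox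
  isSemialgebraicFunOn_integrand :=
    (isSemialgebraicFunOn_aeval isSemialgebraic_ubox
      (Polynomial.aeval (X 0 * X 1 * X 2 : MvPolynomial (Fin 3) ℚ) Q)).congr
      fun x _ => aeval_comp_prod x Q
  integrableOn := by
    have hc : Continuous fun x : Fin 3 → ℝ => Polynomial.aeval (x 0 * x 1 * x 2) Q :=
      (Polynomial.continuous_aeval Q).comp (by fun_prop)
    exact (hc.continuousOn.integrableOn_compact isCompact_Icc).mono_set ubox_subset_Icc

/-- Auxiliary: `polyRep_domain`. [folklore] -/
@[simp] theorem polyRep_domain (Q : Polynomial ℚ) : (polyRep Q).domain = ubox := rfl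

/-- Auxiliary: `polyRep_integrand`. [folklore] -/
@[simp] theorem polyRep_integrand (Q : Polynomial ℚ) :
    (polyRep Q).integrand = fun x => Polynomial.aeval (x 0 * x 1 * x 2) Q := rfl

/-- `polyRep Q` satisfies the integrand hypothesis of the crux with `P = Q * (1 − X²)`. [folklore] -/
theorem polyRep_eqOn (Q : Polynomial ℚ) :
    EqOn (polyRep Q).integrand
      (fun x => Polynomial.aeval (x 0 * x 1 * x 2) (Q * (1 - Polynomial.X ^ 2)) /
        (1 - (x 0 * x 1 * x 2) ^ 2)) (polyRep Q).domain := by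
  intro x hx
  have h := (one_sub_sq_pos hx).ne'
  simp only [polyRep_integrand, map_mul, map_sub, map_one, map_pow, Polynomial.aeval_X]
  rw [mul_div_assoc, div_self h, mul_one]

/-- Value of a monomial member: `∫_{(0,1)³} c·t^k = c/(k+1)³`. [folklore] -/
theorem value_polyRep_monomial (c : ℚ) (k : ℕ) :
    (polyRep (Polynomial.C c * Polynomial.X ^ k)).value = (c : ℝ) / ((k : ℝ) + 1) ^ 3 := by
  have hint : ∫ t in Ioo (0:ℝ) 1, t ^ k = 1 / ((k : ℝ) + 1) := by
    rw [← integral_Ioc_eq_integral_Ioo, ← intervalIntegral.integral_of_le zero_le_one, integral_pow]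
    simp
  have h := setIntegral_pi_prod (fun _ => Ioo (0:ℝ) 1) (fun _ t => t ^ k)
  simp only [Finset.prod_const, Finset.card_univ, Fintype.card_fin] at h
  show ∫ x in ubox, Polynomial.aeval (x 0 * x 1 * x 2) (Polynomial.C c * Polynomial.X ^ k) = _
  have hfun : (fun x : Fin 3 → ℝ => Polynomial.aeval (x 0 * x 1 * x 2) (Polynomial.C c * Polynomial.X ^ k)) =
      fun x => (c : ℝ) * ∏ i, (x i) ^ k := by
    funext x
    simp [Fin.prod_univ_three, mul_pow]
  rw [hfun, MeasureTheory.integral_const_mul, ubox_eq_pi, h, hint]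
  have hk : ((k : ℝ) + 1) ≠ 0 := by positivity
  field_simp

/-- Value of a constant member: `∫_{(0,1)³} c = c`. [folklore] -/
theorem value_polyRep_C (c : ℚ) : (polyRep (Polynomial.C c)).value = c := by
  have h := value_polyRep_monomial c 0
  simp only [pow_zero, mul_one, Nat.cast_zero, zero_add, one_pow, div_one] at h
  exact h

/-! ## §1 Why it resists: the crux is a literal sub-case of the summit -/

/-- Members of the sector have KZ's literal (rational) shape. [folklore] -/
theorem isRational_of_sector {r : KZ.IntegralRep 3} {P : Polynomial ℚ} (hd : r.domain = ubox)
    (hi : EqOn r.integrand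
      (fun x => Polynomial.aeval (x 0 * x 1 * x 2) P / (1 - (x 0 * x 1 * x 2) ^ 2)) r.domain) :
    r.IsRational := by
  refine ⟨Polynomial.aeval (X 0 * X 1 * X 2 : MvPolynomial (Fin 3) ℚ) P,
    1 - (X 0 * X 1 * X 2) ^ 2, ?_, ?_⟩
  · intro x hx
    rw [hd] at hx
    have h := (one_sub_sq_pos hx).ne'
    simpa using h
  · intro x hx
    rw [hi hx]
    simp [aeval_comp_prod]

/-- **Summit-necessity.** `KontsevichZagierPeriods → AperySectorThreeTwo`: the crux is the period
conjecture restricted to the sector, so `¬ AperySectorThreeTwo → ¬ KontsevichZagierPeriods` — a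
refutation of this crux would be a disproof of Conjecture 1 for the H21 calculus. [folklore] -/
theorem aperySectorThreeTwo_of_summit (h : _root_.KontsevichZagierPeriods) : AperySectorThreeTwo := by
  intro r r' P P' hd hd' hi hi' hv
  exact h r r' (isRational_of_sector hd hi) (isRational_of_sector hd' hi') hv

/-! ## §2 Load-bearing hypotheses -/

/-- The crux with the value hypothesis `r.value = r'.value` dropped. [folklore] -/
def AperySectorThreeTwoWithoutValue : Prop :=
  ∀ (r r' : KZ.IntegralRep 3) (P P' : Polynomial ℚ), r.domain = ubox → r'.domain = ubox →
    EqOn r.integrand (fun x => Polynomial.aeval (x 0 * x 1 * x 2) P / (1 - (x 0 * x 1 * x 2) ^ 2)) r.domain →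
    EqOn r'.integrand (fun x => Polynomial.aeval (x 0 * x 1 * x 2) P' / (1 - (x 0 * x 1 * x 2) ^ 2)) r'.domain →
    KZ.Equivalent r r'

/-- The value hypothesis is load-bearing ("any proof must use it"): `[box, 0]` and `[box, 1]`
(`P = 0`, `P' = 1 − X²`) lie in the sector with values `0 ≠ 1`, and the calculus is sound
(`KZ.Equivalent.value_eq_holds`). [folklore] -/
theorem aperySectorThreeTwo_false_without_value : ¬ AperySectorThreeTwoWithoutValue := by
  intro h
  have he := h (polyRep (Polynomial.C 0)) (polyRep (Polynomial.C 1)) _ _ rfl rfl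
    (polyRep_eqOn _) (polyRep_eqOn _)
  have hv := KZ.Equivalent.value_eq_holds he
  rw [value_polyRep_C, value_polyRep_C] at hv
  norm_num at hv

/-! ## §3 Refuted natural strengthenings -/

/-- Strengthening I: equal values force the integrands to agree on the box. [folklore] -/
def AperySectorThreeTwoEqOn : Prop :=
  ∀ (r r' : KZ.IntegralRep 3) (P P' : Polynomial ℚ), r.domain = ubox → r'.domain = ubox →
    EqOn r.integrand (fun x => Polynomial.aeval (x 0 * x 1 * x 2) P / (1 - (x 0 * x 1 * x 2) ^ 2)) r.domain →
    EqOn r'.integrand (fun x => Polynomial.aeval (x 0 * x 1 * x 2) P' / (1 - (x 0 * x 1 * x 2) ^ 2)) r'.domain →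
    r.value = r'.value → EqOn r.integrand r'.integrand ubox

/-- Strengthening II: equal values force equal numerators `P = P'`. [folklore] -/
def AperySectorThreeTwoInjective : Prop :=
  ∀ (r r' : KZ.IntegralRep 3) (P P' : Polynomial ℚ), r.domain = ubox → r'.domain = ubox →
    EqOn r.integrand (fun x => Polynomial.aeval (x 0 * x 1 * x 2) P / (1 - (x 0 * x 1 * x 2) ^ 2)) r.domain →
    EqOn r'.integrand (fun x => Polynomial.aeval (x 0 * x 1 * x 2) P' / (1 - (x 0 * x 1 * x 2) ^ 2)) r'.domain →
    r.value = r'.value → P = P'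

/-- The equal-value pair `[box, 1]`, `[box, 8·x₀x₁x₂]` (values `1 = 8/2³`). [folklore] -/
theorem value_one_eq_value_eightT :
    (polyRep (Polynomial.C 1)).value = (polyRep (Polynomial.C 8 * Polynomial.X ^ 1)).value := by
  rw [value_polyRep_C, value_polyRep_monomial]
  norm_num

/-- Strengthening I is FALSE: `[box, 1]` and `[box, 8t]` have equal values and different
integrands (at `x = (¼,¼,¼)`, `8t = 1/8 ≠ 1`). So the value map is not injective on the sector:
rigidity holds only AFTER reduction to normal form. [folklore] -/
theorem not_aperySectorThreeTwoEqOn : ¬ AperySectorThreeTwoEqOn := by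
  intro h
  have heq := h (polyRep (Polynomial.C 1)) (polyRep (Polynomial.C 8 * Polynomial.X ^ 1)) _ _ rfl rfl
    (polyRep_eqOn _) (polyRep_eqOn _) value_one_eq_value_eightT
  have hx : (fun _ => (1/4 : ℝ) : Fin 3 → ℝ) ∈ ubox := fun i => by norm_num
  have := heq hx
  simp at this
  norm_num at this

/-- Strengthening II is FALSE (same pair: `P = 1 − X²`, `P' = 8X(1 − X²)`). [folklore] -/
theorem not_aperySectorThreeTwoInjective : ¬ AperySectorThreeTwoInjective := by
  intro h
  have heq := h (polyRep (Polynomial.C 1)) (polyRep (Polynomial.C 8 * Polynomial.X ^ 1)) _ _ rfl rfl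
    (polyRep_eqOn _) (polyRep_eqOn _) value_one_eq_value_eightT
  have := congrArg (Polynomial.eval 0) heq
  simp at this

/-! ## §4 Rule (1) alone cannot prove the crux (load-bearing MOVES)

Localised evaluation `evalOn A [r] = ∫_{σ ∩ A n} f` against a family of measurable test sets is an
additive invariant of the two ADDITIVITY moves (same computation as the soundness of rule (1)), but
not of rules (2), (3). It separates the equal-valued pair `[box, 1]`, `[box, 8t]` of §3 (test set:
the sub-box `(0,½)³`, masses `1/8 ≠ 1/64`). Hence every chain of moves between them — and a
fortiori any proof of `AperySectorThreeTwo` — contains a change of variables or a Newton–Leibniz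
move. (The route's chain uses exactly ONE change of variables, the dilation `xᵢ ↦ xᵢ²`.) -/

/-- Localised evaluation against a family of test sets `A n ⊆ ℝⁿ`. [folklore] -/
def evalOn (A : (n : ℕ) → Set (Fin n → ℝ)) : KZ.FormalRep →+ ℝ :=
  FreeAbelianGroup.lift fun s => ∫ x in s.2.domain ∩ A s.1, s.2.integrand x

/-- Auxiliary: `evalOn_of`. [folklore] -/
@[simp] theorem evalOn_of (A : (n : ℕ) → Set (Fin n → ℝ)) {n : ℕ} (r : KZ.IntegralRep n) :
    evalOn A (KZ.of r) = ∫ x in r.domain ∩ A n, r.integrand x :=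
  FreeAbelianGroup.lift_apply_of _ _

/-- The sub-calculus generated by the two additivity moves only. [folklore] -/
def addOnlyRelations : AddSubgroup KZ.FormalRep :=
  AddSubgroup.closure (KZ.domainAddRel ∪ KZ.integrandAddRel)

/-- The additivity-only sub-calculus is part of the KZ calculus. [folklore] -/
theorem addOnlyRelations_le_relations : addOnlyRelations ≤ KZ.relations := by
  refine (AddSubgroup.closure_le _).mpr ?_
  rintro c (hc | hc)
  · exact KZ.domainAddRel_subset_relations hc
  · exact KZ.integrandAddRel_subset_relations hc

/-- Localised evaluation kills domain additivity. [folklore] -/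
theorem evalOn_eq_zero_of_mem_domainAddRel {A : (n : ℕ) → Set (Fin n → ℝ)}
    (hA : ∀ n, MeasurableSet (A n)) {c : KZ.FormalRep} (hc : c ∈ KZ.domainAddRel) :
    evalOn A c = 0 := by
  obtain ⟨n, r, r₁, r₂, hdom, hnull, h₁, h₂, rfl⟩ := hc
  simp only [map_sub, evalOn_of]
  rw [sub_sub, sub_eq_zero]
  have hm₁ : MeasurableSet (r₁.domain ∩ A n) :=
    (KZ.IntegralRep.measurableSet_domain_holds r₁).inter (hA n)
  have hm₂ : MeasurableSet (r₂.domain ∩ A n) :=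
    (KZ.IntegralRep.measurableSet_domain_holds r₂).inter (hA n)
  have hae : AEDisjoint volume (r₁.domain ∩ A n) (r₂.domain ∩ A n) :=
    measure_mono_null (inter_subset_inter inter_subset_left inter_subset_left) hnull
  have hset : r.domain ∩ A n = (r₁.domain ∩ A n) ∪ (r₂.domain ∩ A n) := by
    rw [hdom, union_inter_distrib_right]
  have hi₁ : IntegrableOn r.integrand (r₁.domain ∩ A n) :=
    r.integrableOn.mono_set (by rw [hdom]; exact inter_subset_left.trans subset_union_left)
  have hi₂ : IntegrableOn r.integrand (r₂.domain ∩ A n) :=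
    r.integrableOn.mono_set (by rw [hdom]; exact inter_subset_left.trans subset_union_right)
  rw [hset, setIntegral_union₀ hae hm₂.nullMeasurableSet hi₁ hi₂,
    setIntegral_congr_fun hm₁ (h₁.mono inter_subset_left),
    setIntegral_congr_fun hm₂ (h₂.mono inter_subset_left)]

/-- Localised evaluation kills integrand additivity. [folklore] -/
theorem evalOn_eq_zero_of_mem_integrandAddRel {A : (n : ℕ) → Set (Fin n → ℝ)}
    (hA : ∀ n, MeasurableSet (A n)) {c : KZ.FormalRep} (hc : c ∈ KZ.integrandAddRel) :
    evalOn A c = 0 := by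
  obtain ⟨n, r, r₁, r₂, h₁, h₂, hadd, rfl⟩ := hc
  simp only [map_sub, evalOn_of]
  rw [sub_sub, sub_eq_zero, h₁, h₂]
  have hm : MeasurableSet (r.domain ∩ A n) :=
    (KZ.IntegralRep.measurableSet_domain_holds r).inter (hA n)
  rw [setIntegral_congr_fun hm (hadd.mono inter_subset_left)]
  exact integral_add (r₁.integrableOn.mono_set (by rw [h₁]; exact inter_subset_left))
    (r₂.integrableOn.mono_set (by rw [h₂]; exact inter_subset_left))

/-- The additivity-only sub-calculus lies in the kernel of every localised evaluation. [folklore] -/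
theorem addOnlyRelations_le_ker_evalOn {A : (n : ℕ) → Set (Fin n → ℝ)}
    (hA : ∀ n, MeasurableSet (A n)) : addOnlyRelations ≤ (evalOn A).ker := by
  refine (AddSubgroup.closure_le _).mpr ?_
  rintro c (hc | hc)
  · exact evalOn_eq_zero_of_mem_domainAddRel hA hc
  · exact evalOn_eq_zero_of_mem_integrandAddRel hA hc

/-- The test family: the corner `{x | ∀ i, xᵢ < ½}` in every dimension. [folklore] -/
def corner (n : ℕ) : Set (Fin n → ℝ) := {x | ∀ i, x i < 2⁻¹}

/-- Auxiliary: `measurableSet_corner`. [folklore] -/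
theorem measurableSet_corner (n : ℕ) : MeasurableSet (corner n) := by
  have : corner n = Set.pi univ fun _ => Iio (2⁻¹ : ℝ) := by ext x; simp [corner]
  rw [this]
  exact MeasurableSet.univ_pi fun _ => measurableSet_Iio

/-- Auxiliary: `ubox_inter_corner`. [folklore] -/
theorem ubox_inter_corner : ubox ∩ corner 3 = Set.pi univ fun _ => Ioo (0:ℝ) 2⁻¹ := by
  ext x
  simp only [ubox, corner, mem_inter_iff, mem_setOf_eq, mem_Ioo, mem_univ_pi]
  constructor
  · rintro ⟨h1, h2⟩ i
    exact ⟨(h1 i).1, h2 i⟩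
  · intro h
    exact ⟨fun i => ⟨(h i).1, (h i).2.trans (by norm_num)⟩, fun i => (h i).2⟩

/-- Mass of `[box, 1]` in the corner: `1/8`. [folklore] -/
theorem evalOn_corner_one :
    evalOn corner (KZ.of (polyRep (Polynomial.C 1))) = 1 / 8 := by
  rw [evalOn_of, polyRep_domain, ubox_inter_corner]
  have h := setIntegral_pi_prod (fun _ => Ioo (0:ℝ) 2⁻¹) (fun _ _ => (1 : ℝ))
  simp only [Finset.prod_const_one] at h
  simp only [polyRep_integrand, map_one]
  rw [h]
  simp
  norm_num

/-- Mass of `[box, 8t]` in the corner: `1/64`. [folklore] -/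
theorem evalOn_corner_eightT :
    evalOn corner (KZ.of (polyRep (Polynomial.C 8 * Polynomial.X ^ 1))) = 1 / 64 := by
  rw [evalOn_of, polyRep_domain, ubox_inter_corner]
  have hint : ∫ t in Ioo (0:ℝ) 2⁻¹, t ^ 1 = 1 / 8 := by
    rw [← integral_Ioc_eq_integral_Ioo, ← intervalIntegral.integral_of_le (by norm_num), integral_pow]
    norm_num
  have h := setIntegral_pi_prod (fun _ => Ioo (0:ℝ) 2⁻¹) (fun _ t => t ^ 1)
  simp only [Finset.prod_const, Finset.card_univ, Fintype.card_fin, hint] at h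
  have hfun : (polyRep (Polynomial.C 8 * Polynomial.X ^ 1)).integrand =
      fun x => (8 : ℝ) * ∏ i, (x i) ^ 1 := by
    funext x
    simp [Fin.prod_univ_three]
  rw [hfun, MeasureTheory.integral_const_mul, h]
  norm_num

/-- `[box, 1] − [box, 8t]` is NOT in the additivity-only sub-calculus. [folklore] -/
theorem one_sub_eightT_not_mem_addOnlyRelations :
    KZ.of (polyRep (Polynomial.C 1)) - KZ.of (polyRep (Polynomial.C 8 * Polynomial.X ^ 1)) ∉
      addOnlyRelations := by
  intro hmem
  have h0 := addOnlyRelations_le_ker_evalOn measurableSet_corner hmem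
  rw [AddMonoidHom.mem_ker, map_sub, evalOn_corner_one, evalOn_corner_eightT] at h0
  norm_num at h0

/-- **Rule (1) is not enough.** There is a pair in the sector with equal values whose difference
lies outside `closure (domainAddRel ∪ integrandAddRel)`: any proof of `AperySectorThreeTwo` must
use a change of variables (rule 2) or a Newton–Leibniz move (rule 3). [folklore] -/
theorem aperySectorThreeTwo_needs_rule_two_or_three :
    ∃ (r r' : KZ.IntegralRep 3) (P P' : Polynomial ℚ), r.domain = ubox ∧ r'.domain = ubox ∧
      EqOn r.integrand (fun x => Polynomial.aeval (x 0 * x 1 * x 2) P / (1 - (x 0 * x 1 * x 2) ^ 2)) r.domain ∧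
      EqOn r'.integrand (fun x => Polynomial.aeval (x 0 * x 1 * x 2) P' / (1 - (x 0 * x 1 * x 2) ^ 2)) r'.domain ∧
      r.value = r'.value ∧ KZ.of r - KZ.of r' ∉ addOnlyRelations :=
  ⟨polyRep (Polynomial.C 1), polyRep (Polynomial.C 8 * Polynomial.X ^ 1), _, _, rfl, rfl,
    polyRep_eqOn _, polyRep_eqOn _, value_one_eq_value_eightT,
    one_sub_eightT_not_mem_addOnlyRelations⟩

/-! ## §5 Non-vacuity for EVERY numerator, and the polar pair `h₀ = 7h₁`

`sectorRep P = [ (0,1)³, P(t)/(1 − t²) ]` is the canonical inhabitant of the hypotheses (the typed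
integrand verbatim; absolute integrability from the tree's
`BoxIntegral.integrableOn_box_prod_pow_div_one_sub_prod_pow`), so the `∀ r r' P P'` is non-empty
for every pair of numerators. The polar pair `[box, 1/(1−t²)]`, `[box, 7t/(1−t²)]` has equal
values (`h₀ = 7ζ(3)/8 = 7h₁`, tree: `BoxIntegral.box_integral_level_two_weight_three_zero/one`)
and is again separated by the corner mass, so the distribution relation `H₀ ∼ 7H₁` is NOT an
additivity relation either: the one dilation of the route is unavoidable modulo rule (3). -/

/-- The canonical member `[ (0,1)³, P(x₀x₁x₂)/(1 − (x₀x₁x₂)²) ]` of the sector. [folklore] -/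
def sectorRep (P : Polynomial ℚ) : KZ.IntegralRep 3 where
  domain := ubox
  integrand x := Polynomial.aeval (x 0 * x 1 * x 2) P / (1 - (x 0 * x 1 * x 2) ^ 2)
  isSemialgebraic_domain := isSemialgebraic_ubox
  isSemialgebraicFunOn_integrand := by
    refine (isSemialgebraicFunOn_aeval_div_aeval isSemialgebraic_ubox
      (Polynomial.aeval (X 0 * X 1 * X 2 : MvPolynomial (Fin 3) ℚ) P)
      (1 - (X 0 * X 1 * X 2) ^ 2) ?_).congr ?_
    · intro x hx
      simpa using (one_sub_sq_pos hx).ne'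
    · intro x _
      simp [aeval_comp_prod]
  integrableOn := by
    have h : ∀ i : ℕ, IntegrableOn
        (fun x : Fin 3 → ℝ => (x 0 * x 1 * x 2) ^ i / (1 - (x 0 * x 1 * x 2) ^ 2)) ubox := by
      intro i
      have := BoxIntegral.integrableOn_box_prod_pow_div_one_sub_prod_pow (n := 3) (by norm_num)
        (m := 2) (by norm_num) i
      simp only [Fin.prod_univ_three] at this
      exact this
    have hsum : IntegrableOn (fun x : Fin 3 → ℝ => ∑ i ∈ Finset.range (P.natDegree + 1),
        (P.coeff i : ℝ) * ((x 0 * x 1 * x 2) ^ i / (1 - (x 0 * x 1 * x 2) ^ 2))) ubox :=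
      integrable_finsetSum _ fun i _ => (h i).const_mul _
    refine hsum.congr_fun (fun x _ => ?_) measurableSet_ubox
    rw [Polynomial.aeval_eq_sum_range, Finset.sum_div]
    refine Finset.sum_congr rfl fun i _ => ?_
    rw [Algebra.smul_def, mul_div_assoc]
    simp

/-- Auxiliary: `sectorRep_domain`. [folklore] -/
@[simp] theorem sectorRep_domain (P : Polynomial ℚ) : (sectorRep P).domain = ubox := rfl

/-- Auxiliary: `sectorRep_integrand`. [folklore] -/
@[simp] theorem sectorRep_integrand (P : Polynomial ℚ) :
    (sectorRep P).integrand =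
      fun x => Polynomial.aeval (x 0 * x 1 * x 2) P / (1 - (x 0 * x 1 * x 2) ^ 2) := rfl

/-- **Non-vacuity for every numerator**: the hypotheses of the crux on `(r, P)` are satisfiable
for every `P ∈ ℚ[t]` (the pole at `t = 1` is simple against a triple integral: absolutely
convergent). [folklore] -/
theorem hypotheses_satisfiable (P : Polynomial ℚ) :
    ∃ r : KZ.IntegralRep 3, r.domain = ubox ∧
      EqOn r.integrand (fun x => Polynomial.aeval (x 0 * x 1 * x 2) P / (1 - (x 0 * x 1 * x 2) ^ 2))
        r.domain :=
  ⟨sectorRep P, rfl, fun _ _ => rfl⟩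

/-- `h₀`: the value of `[box, 1/(1−t²)]` is `7ζ(3)/8` (tree: Beukers/Apéry files). [folklore] -/
theorem value_sectorRep_one : (sectorRep (Polynomial.C 1)).value = 7 / 8 * zetaValue 3 := by
  rw [← BoxIntegral.box_integral_level_two_weight_three_zero.2]
  show ∫ x in ubox, (sectorRep (Polynomial.C 1)).integrand x = _
  refine setIntegral_congr_fun measurableSet_ubox fun x _ => ?_
  simp

/-- `7h₁`: the value of `[box, 7t/(1−t²)]` is `7ζ(3)/8` as well. [folklore] -/
theorem value_sectorRep_sevenX :
    (sectorRep (Polynomial.C 7 * Polynomial.X ^ 1)).value = 7 / 8 * zetaValue 3 := by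
  have h := BoxIntegral.box_integral_level_two_weight_three_one.2
  have h7 : ∫ x in ubox, (7 : ℝ) * ((x 0 * x 1 * x 2) ^ 1 / (1 - (x 0 * x 1 * x 2) ^ 2)) =
      7 / 8 * zetaValue 3 := by
    rw [MeasureTheory.integral_const_mul]
    show 7 * ∫ x in {x : Fin 3 → ℝ | ∀ i, x i ∈ Ioo (0:ℝ) 1},
      (x 0 * x 1 * x 2) ^ 1 / (1 - (x 0 * x 1 * x 2) ^ 2) = _
    rw [h]; ring
  rw [← h7]
  show ∫ x in ubox, (sectorRep (Polynomial.C 7 * Polynomial.X ^ 1)).integrand x = _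
  refine setIntegral_congr_fun measurableSet_ubox fun x _ => ?_
  simp [mul_div_assoc]

/-- The polar pair has equal values: `h₀ = 7h₁` (the `m = 2` distribution relation). [folklore] -/
theorem polar_value_eq :
    (sectorRep (Polynomial.C 1)).value = (sectorRep (Polynomial.C 7 * Polynomial.X ^ 1)).value := by
  rw [value_sectorRep_one, value_sectorRep_sevenX]

/-- On the corner sub-box `t = x₀x₁x₂ < 1/8`. [folklore] -/
theorem prod_lt_of_mem_corner {x : Fin 3 → ℝ} (hx : x ∈ Set.pi univ fun _ => Ioo (0:ℝ) 2⁻¹) :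
    0 < x 0 * x 1 * x 2 ∧ x 0 * x 1 * x 2 < 8⁻¹ := by
  rw [mem_univ_pi] at hx
  have h0 := hx 0; have h1 := hx 1; have h2 := hx 2
  refine ⟨by have := h0.1; have := h1.1; have := h2.1; positivity, ?_⟩
  have := mul_lt_mul'' (mul_lt_mul'' h0.2 h1.2 h0.1.le h1.1.le) h2.2
    (mul_nonneg h0.1.le h1.1.le) h2.1.le
  have h8 : (2⁻¹ : ℝ) * 2⁻¹ * 2⁻¹ = 8⁻¹ := by norm_num
  linarith [h8]

/-- The corner separates the polar pair: `∫_{(0,½)³} (1 − 7t)/(1 − t²) ≥ 1/64 > 0`, so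
`[box, 1/(1−t²)] − [box, 7t/(1−t²)] ∉ closure (domainAddRel ∪ integrandAddRel)` — the
distribution relation `H₀ ∼ 7H₁` is not an additivity relation. [folklore] -/
theorem polar_not_mem_addOnlyRelations :
    KZ.of (sectorRep (Polynomial.C 1)) - KZ.of (sectorRep (Polynomial.C 7 * Polynomial.X ^ 1)) ∉
      addOnlyRelations := by
  intro hmem
  have h0 := addOnlyRelations_le_ker_evalOn measurableSet_corner hmem
  rw [AddMonoidHom.mem_ker, map_sub, evalOn_of, evalOn_of, sectorRep_domain, sectorRep_domain,
    ubox_inter_corner] at h0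
  set C : Set (Fin 3 → ℝ) := Set.pi univ fun _ => Ioo (0:ℝ) 2⁻¹ with hC
  have hCm : MeasurableSet C := MeasurableSet.univ_pi fun _ => measurableSet_Ioo
  have hCsub : C ⊆ ubox := by
    intro x hx
    rw [hC, mem_univ_pi] at hx
    exact fun i => ⟨(hx i).1, (hx i).2.trans (by norm_num)⟩
  have hvol : volume C = ENNReal.ofReal 8⁻¹ := by
    rw [hC, volume_pi_pi]
    simp only [Real.volume_Ioo, Finset.prod_const, Finset.card_univ, Fintype.card_fin, sub_zero]
    rw [← ENNReal.ofReal_pow (by norm_num)]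
    norm_num
  have hvolr : volume.real C = 8⁻¹ := by
    simp [Measure.real, hvol]
  have hi1 : IntegrableOn (sectorRep (Polynomial.C 1)).integrand C :=
    (sectorRep _).integrableOn.mono_set hCsub
  have hi7 : IntegrableOn (sectorRep (Polynomial.C 7 * Polynomial.X ^ 1)).integrand C :=
    (sectorRep _).integrableOn.mono_set hCsub
  have hsub : (∫ x in C, (sectorRep (Polynomial.C 1)).integrand x) -
      (∫ x in C, (sectorRep (Polynomial.C 7 * Polynomial.X ^ 1)).integrand x) =
      ∫ x in C, ((sectorRep (Polynomial.C 1)).integrand x -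
        (sectorRep (Polynomial.C 7 * Polynomial.X ^ 1)).integrand x) :=
    (integral_sub hi1 hi7).symm
  have hconst : IntegrableOn (fun _ : Fin 3 → ℝ => (8⁻¹ : ℝ)) C := by
    refine integrableOn_const ?_
    rw [hvol]; exact ENNReal.ofReal_ne_top
  have hle : ∫ _ in C, (8⁻¹ : ℝ) ≤ ∫ x in C, ((sectorRep (Polynomial.C 1)).integrand x -
        (sectorRep (Polynomial.C 7 * Polynomial.X ^ 1)).integrand x) := by
    refine setIntegral_mono_on hconst (hi1.sub hi7) hCm fun x hx => ?_
    obtain ⟨ht0, ht8⟩ := prod_lt_of_mem_corner hx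
    have hb : 0 < 1 - (x 0 * x 1 * x 2) ^ 2 := one_sub_sq_pos (hCsub hx)
    simp only [sectorRep_integrand, map_one, map_mul, Polynomial.aeval_C, map_pow,
      Polynomial.aeval_X, eq_ratCast]
    rw [← sub_div, le_div_iff₀ hb]
    push_cast
    nlinarith
  have hcv : ∫ _ in C, (8⁻¹ : ℝ) = 64⁻¹ := by
    rw [setIntegral_const, hvolr]
    norm_num
  rw [hsub] at h0
  linarith

/-- **Rule (1) is not enough for the polar part either**: an equal-valued pair of GENUINE polar
members (`P = 1`, `P' = 7X`) outside the additivity-only sub-calculus. [folklore] -/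
theorem aperySectorThreeTwo_polar_needs_rule_two_or_three :
    ∃ (r r' : KZ.IntegralRep 3) (P P' : Polynomial ℚ), r.domain = ubox ∧ r'.domain = ubox ∧
      EqOn r.integrand (fun x => Polynomial.aeval (x 0 * x 1 * x 2) P / (1 - (x 0 * x 1 * x 2) ^ 2)) r.domain ∧
      EqOn r'.integrand (fun x => Polynomial.aeval (x 0 * x 1 * x 2) P' / (1 - (x 0 * x 1 * x 2) ^ 2)) r'.domain ∧
      r.value = r'.value ∧ KZ.of r - KZ.of r' ∉ addOnlyRelations :=
  ⟨sectorRep (Polynomial.C 1), sectorRep (Polynomial.C 7 * Polynomial.X ^ 1), _, _, rfl, rfl,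
    fun _ _ => rfl, fun _ _ => rfl, polar_value_eq, polar_not_mem_addOnlyRelations⟩

/-! ## §6 Tightness of §4–§5: the ONE move that rule (1) lacks is available (positive, for provers)

The dilation `xᵢ ↦ xᵢᵐ` on the open box is a single `changeOfVariablesRel` instance in dimension
`3` (`dilation_mem_changeOfVariablesRel`; all analysis from the tree's
`BoxCoordinatePowerMap.lean`: derivative `diag(m xᵢ^{m−1})`, `|det| = m³∏xᵢ^{m−1}`, injectivity,
`Φ '' box = box`). Consequences: the two pairs that §4–§5 put OUTSIDE the additivity-only
sub-calculus are connected by rule (2) (+ rule (1b) for the polar pair):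
`poly_pair_mem_changeOfVariablesRel` (`[box, 8t] − [box, 1]`, `m = 2`, `g = 1`),
`polar_dilation_mem_changeOfVariablesRel` (`[box, 8t/(1−t²)] − [box, (1+t)/(1−t²)]`, `m = 2`,
`g = 1/(1−s)`), and `polar_equivalent : [box, 1/(1−t²)] ~ [box, 7t/(1−t²)]` — the distribution
relation `H₀ ∼ 7H₁` as an honest KZ-equivalence (one dilation, two integrand additivities).
These are positive facts (a prover may copy them); they certify that §4's obstruction is sharp. -/

/-- **The dilation move in dimension 3.** For `m ≥ 1` and reps `r`, `r'` on the open box with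
`r.integrand x = r'.integrand (xᵢᵐ)ᵢ · m³ ∏ xᵢ^{m−1}` on the box, `[r] − [r']` is ONE
change-of-variables move (item DilationMove at `n = 3`). [folklore] -/
theorem dilation_mem_changeOfVariablesRel {m : ℕ} (hm : m ≠ 0) (r r' : KZ.IntegralRep 3)
    (hd : r.domain = ubox) (hd' : r'.domain = ubox)
    (h : ∀ x ∈ ubox, r.integrand x =
      r'.integrand (BoxIntegral.coordPow m x) * ((m : ℝ) ^ 3 * ∏ i, x i ^ (m - 1))) :
    KZ.of r - KZ.of r' ∈ KZ.changeOfVariablesRel := by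
  refine ⟨3, r, r', BoxIntegral.coordPow m, BoxIntegral.coordPowDeriv m, ?_, ?_, ?_, ?_, ?_, rfl⟩
  · rw [hd]
    exact (isSemialgebraicMapOn_aeval isSemialgebraic_ubox
      (fun i => (X i : MvPolynomial (Fin 3) ℚ) ^ m)).congr fun x _ => by
        funext j; simp
  · intro x _
    exact BoxIntegral.hasFDerivWithinAt_coordPow m _ x
  · rw [hd]
    exact BoxIntegral.injOn_coordPow_box hm
  · rw [hd, hd']
    exact (BoxIntegral.image_coordPow_box hm).symm
  · intro x hx
    rw [hd] at hx
    rw [h x hx, BoxIntegral.abs_det_coordPowDeriv hm hx]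

/-- The polynomial pair of §3–§4 is ONE dilation (`m = 2`, `g ≡ 1`):
`[box, 8t] − [box, 1] ∈ changeOfVariablesRel`. [folklore] -/
theorem poly_pair_mem_changeOfVariablesRel :
    KZ.of (polyRep (Polynomial.C 8 * Polynomial.X ^ 1)) - KZ.of (polyRep (Polynomial.C 1)) ∈
      KZ.changeOfVariablesRel := by
  refine dilation_mem_changeOfVariablesRel (m := 2) two_ne_zero _ _ rfl rfl fun x _ => ?_
  simp only [polyRep_integrand, map_mul, Polynomial.aeval_C, map_pow, Polynomial.aeval_X, map_one,
    BoxIntegral.coordPow_apply, Fin.prod_univ_three, eq_ratCast]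
  push_cast
  ring

/-- Hence the polynomial pair is KZ-equivalent (one move). [folklore] -/
theorem poly_pair_equivalent :
    KZ.Equivalent (polyRep (Polynomial.C 1)) (polyRep (Polynomial.C 8 * Polynomial.X ^ 1)) :=
  KZ.Equivalent.symm (KZ.changeOfVariablesRel_subset_relations poly_pair_mem_changeOfVariablesRel)

/-- The polar dilation (`m = 2`, `g = 1/(1 − s) = (1+s)/(1−s²)`):
`[box, 8t/(1−t²)] − [box, (1+t)/(1−t²)] ∈ changeOfVariablesRel` (`8H₁ ∼ H₀ + H₁`). [folklore] -/
theorem polar_dilation_mem_changeOfVariablesRel :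
    KZ.of (sectorRep (Polynomial.C 8 * Polynomial.X ^ 1)) - KZ.of (sectorRep (1 + Polynomial.X)) ∈
      KZ.changeOfVariablesRel := by
  refine dilation_mem_changeOfVariablesRel (m := 2) two_ne_zero _ _ rfl rfl fun x hx => ?_
  have ht := prod_mem_Ioo hx
  have hsq : (x 0 * x 1 * x 2) ^ 2 < 1 := by nlinarith [ht.1, ht.2]
  have hA : (1 : ℝ) - (x 0 * x 1 * x 2) ^ 2 ≠ 0 := by linarith
  have hB : (1 : ℝ) - (x 0 ^ 2 * x 1 ^ 2 * x 2 ^ 2) ^ 2 ≠ 0 := by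
    have : (x 0 ^ 2 * x 1 ^ 2 * x 2 ^ 2) ^ 2 = ((x 0 * x 1 * x 2) ^ 2) ^ 2 := by ring
    rw [this]
    have h0 : 0 ≤ (x 0 * x 1 * x 2) ^ 2 := sq_nonneg _
    have hlt : ((x 0 * x 1 * x 2) ^ 2) ^ 2 < 1 := by nlinarith
    linarith
  simp only [sectorRep_integrand, BoxIntegral.coordPow_apply, Fin.prod_univ_three, map_mul,
    Polynomial.aeval_C, map_pow, Polynomial.aeval_X, map_add, map_one, eq_ratCast]
  push_cast
  rw [eq_comm, div_mul_eq_mul_div, div_eq_div_iff hB hA]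
  ring

/-- Integrand additivity inside the sector: `[P₁ + P₂] − [P₁] − [P₂] ∈ integrandAddRel`. [folklore] -/
theorem sectorRep_add_mem_integrandAddRel (P₁ P₂ : Polynomial ℚ) :
    KZ.of (sectorRep (P₁ + P₂)) - KZ.of (sectorRep P₁) - KZ.of (sectorRep P₂) ∈
      KZ.integrandAddRel := by
  refine ⟨3, sectorRep (P₁ + P₂), sectorRep P₁, sectorRep P₂, rfl, rfl, fun x _ => ?_, rfl⟩
  simp only [sectorRep_integrand, Pi.add_apply, map_add, add_div]

/-- **The distribution relation as an honest KZ-equivalence**: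
`[box, 1/(1−t²)] ~ [box, 7t/(1−t²)]` by ONE dilation and TWO integrand additivities
(`[1] − [7t] = −([1+t]−[1]−[t]) − ([8t]−[1+t]) + ([8t]−[t]−[7t])`). [folklore] -/
theorem polar_equivalent :
    KZ.Equivalent (sectorRep (Polynomial.C 1)) (sectorRep (Polynomial.C 7 * Polynomial.X ^ 1)) := by
  have hA : KZ.of (sectorRep (Polynomial.C 1 + Polynomial.X ^ 1)) - KZ.of (sectorRep (Polynomial.C 1)) -
      KZ.of (sectorRep (Polynomial.X ^ 1)) ∈ KZ.relations :=
    KZ.integrandAddRel_subset_relations (sectorRep_add_mem_integrandAddRel _ _)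
  have hB : KZ.of (sectorRep (Polynomial.C 8 * Polynomial.X ^ 1)) -
      KZ.of (sectorRep (Polynomial.C 1 + Polynomial.X ^ 1)) ∈ KZ.relations := by
    have h := KZ.changeOfVariablesRel_subset_relations polar_dilation_mem_changeOfVariablesRel
    have he : sectorRep (1 + Polynomial.X) = sectorRep (Polynomial.C 1 + Polynomial.X ^ 1) := by
      simp
    rwa [he] at h
  have hC : KZ.of (sectorRep (Polynomial.X ^ 1 + Polynomial.C 7 * Polynomial.X ^ 1)) -
      KZ.of (sectorRep (Polynomial.X ^ 1)) - KZ.of (sectorRep (Polynomial.C 7 * Polynomial.X ^ 1)) ∈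
      KZ.relations :=
    KZ.integrandAddRel_subset_relations (sectorRep_add_mem_integrandAddRel _ _)
  have he8 : sectorRep (Polynomial.X ^ 1 + Polynomial.C 7 * Polynomial.X ^ 1) =
      sectorRep (Polynomial.C 8 * Polynomial.X ^ 1) := by
    congr 1
    have h7 : (Polynomial.C (7 : ℚ)) = 7 := rfl
    have h8 : (Polynomial.C (8 : ℚ)) = 8 := rfl
    rw [h7, h8]; ring
  rw [he8] at hC
  have : KZ.of (sectorRep (Polynomial.C 1)) - KZ.of (sectorRep (Polynomial.C 7 * Polynomial.X ^ 1)) =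
      -(KZ.of (sectorRep (Polynomial.C 1 + Polynomial.X ^ 1)) - KZ.of (sectorRep (Polynomial.C 1)) -
          KZ.of (sectorRep (Polynomial.X ^ 1))) -
        (KZ.of (sectorRep (Polynomial.C 8 * Polynomial.X ^ 1)) -
          KZ.of (sectorRep (Polynomial.C 1 + Polynomial.X ^ 1))) +
        (KZ.of (sectorRep (Polynomial.C 8 * Polynomial.X ^ 1)) - KZ.of (sectorRep (Polynomial.X ^ 1)) -
          KZ.of (sectorRep (Polynomial.C 7 * Polynomial.X ^ 1))) := by
    abel
  show KZ.of (sectorRep (Polynomial.C 1)) - KZ.of (sectorRep (Polynomial.C 7 * Polynomial.X ^ 1)) ∈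
    KZ.relations
  rw [this]
  exact KZ.relations.add_mem (KZ.relations.sub_mem (KZ.relations.neg_mem hA) hB) hC

end Summit.KontsevichZagierPeriods.KontsevichZagierPeriods.Cruxes.AperySectorThreeTwo.Disproof

end

/-! ## §7 THE CRUX IS TRUE — complete proof (also attached as evidence `AperySectorThreeTwoProofStandalone.lean`)

VERDICT (cycle 1, 2026-08-16T00:52Z): `AperySectorThreeTwo` is PROVED below
(`Proof.aperySectorThreeTwo`, 0 sorry, axioms `propext`, `Classical.choice`, `Quot.sound`), so no
kill exists. The chain is the NL-free one announced in the notes above: `Rel P N :=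
[box, P/(1−t²)] − [box, N/(1−t²)] ∈ relations`; `rel_monomial` (one dilation `m = k+1` flattens
`c·tᵏ` to the constant `c/(k+1)³`), `rel_polar` (`[c] ∼ [7c·t]`: dilation `m = 2` + two
integrand additivities), `rel_nf` (`P = Q(1−X²) + α + βX ⇝ nf P = qsum·(1−X²) + (7α+β)·X` by
`modByMonic` against `X² − 1` and `as_sum_range_C_mul_X_pow`), `value_nf` (`a + b·ζ(3)/8`),
`nf_eq_of_value_eq` (Apéry via `BoxIntegral.normalForm_weight_three_coeff_eq`), assembly by
`KZ.of_sub_of_mem_relations_of_eqOn` for the two given reps. An independent complete proof by the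
crux-ideate seat k3 (`AperySectorThreeTwo_Ideator3_Proof.lean`, 00:41Z) is also on the item. A
PROVER should land one of them as `Theorems/HurwitzMicroSectorsAperySectorThreeTwo.lean`. -/

noncomputable section

set_option linter.dupNamespace false

open MeasureTheory Set
open Polynomial
open Literature.NumberTheory.Transcendental Literature.ModelTheory.ExponentialFields

namespace Summit.KontsevichZagierPeriods.KontsevichZagierPeriods.Cruxes.AperySectorThreeTwo.Disproof

open Summit.KontsevichZagierPeriods.KontsevichZagierPeriods.Theses.HurwitzMicroSectors
  (AperySectorThreeTwo)

namespace Proof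

/-! ### §7.1 The relation `Rel P N : [box, P/(1−t²)] − [box, N/(1−t²)] ∈ relations` -/

/-- Two numerators are related if their sector members differ by a KZ relation. [folklore] -/
def Rel (P N : ℚ[X]) : Prop := KZ.of (sectorRep P) - KZ.of (sectorRep N) ∈ KZ.relations

/-- Auxiliary: `Rel.refl`. [folklore] -/
theorem Rel.refl (P : ℚ[X]) : Rel P P := by
  simp [Rel, KZ.relations.zero_mem]

/-- Auxiliary: `Rel.of_eq`. [folklore] -/
theorem Rel.of_eq {P N : ℚ[X]} (h : P = N) : Rel P N := h ▸ Rel.refl P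

/-- Auxiliary: `Rel.symm`. [folklore] -/
theorem Rel.symm {P N : ℚ[X]} (h : Rel P N) : Rel N P := by
  have := KZ.relations.neg_mem h
  simpa [Rel] using this

/-- Auxiliary: `Rel.trans`. [folklore] -/
theorem Rel.trans {P N M : ℚ[X]} (h : Rel P N) (h' : Rel N M) : Rel P M := by
  have := KZ.relations.add_mem h h'
  simpa [Rel] using this

/-- Integrand additivity inside the sector: `[P₁ + P₂] − [P₁] − [P₂] ∈ integrandAddRel`. [folklore] -/
theorem of_add_sub_sub_mem (P₁ P₂ : ℚ[X]) :
    KZ.of (sectorRep (P₁ + P₂)) - KZ.of (sectorRep P₁) - KZ.of (sectorRep P₂) ∈ KZ.relations := by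
  refine KZ.integrandAddRel_subset_relations
    ⟨3, sectorRep (P₁ + P₂), sectorRep P₁, sectorRep P₂, rfl, rfl, fun x _ => ?_, rfl⟩
  simp only [sectorRep_integrand, Pi.add_apply, map_add, add_div]

/-- `Rel` is additive. [folklore] -/
theorem Rel.add {P₁ N₁ P₂ N₂ : ℚ[X]} (h₁ : Rel P₁ N₁) (h₂ : Rel P₂ N₂) :
    Rel (P₁ + P₂) (N₁ + N₂) := by
  have hP := of_add_sub_sub_mem P₁ P₂
  have hN := of_add_sub_sub_mem N₁ N₂
  have : KZ.of (sectorRep (P₁ + P₂)) - KZ.of (sectorRep (N₁ + N₂)) =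
      (KZ.of (sectorRep (P₁ + P₂)) - KZ.of (sectorRep P₁) - KZ.of (sectorRep P₂)) +
        (KZ.of (sectorRep P₁) - KZ.of (sectorRep N₁)) +
        (KZ.of (sectorRep P₂) - KZ.of (sectorRep N₂)) -
        (KZ.of (sectorRep (N₁ + N₂)) - KZ.of (sectorRep N₁) - KZ.of (sectorRep N₂)) := by
    abel
  show KZ.of (sectorRep (P₁ + P₂)) - KZ.of (sectorRep (N₁ + N₂)) ∈ KZ.relations
  rw [this]
  exact KZ.relations.sub_mem (KZ.relations.add_mem (KZ.relations.add_mem hP h₁) h₂) hN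

/-- `Rel` over finite sums. [folklore] -/
theorem Rel.sum {ι : Type*} (s : Finset ι) (P N : ι → ℚ[X]) (h : ∀ i ∈ s, Rel (P i) (N i)) :
    Rel (∑ i ∈ s, P i) (∑ i ∈ s, N i) := by
  classical
  induction s using Finset.induction_on with
  | empty => simpa using Rel.refl 0
  | insert a s ha ih =>
    rw [Finset.sum_insert ha, Finset.sum_insert ha]
    exact (h a (Finset.mem_insert_self a s)).add
      (ih fun i hi => h i (Finset.mem_insert_of_mem hi))

/-! ### §7.2 The two dilations -/

/-- On the box, the member with numerator `R·(1 − X²)` has integrand `R(t)` (the pole cancels). [folklore] -/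
theorem integrand_mul_one_sub_sq (R : ℚ[X]) {x : Fin 3 → ℝ} (hx : x ∈ ubox) :
    (sectorRep (R * (1 - X ^ 2))).integrand x = Polynomial.aeval (x 0 * x 1 * x 2) R := by
  have h := (one_sub_sq_pos hx).ne'
  simp only [sectorRep_integrand, map_mul, map_sub, map_one, map_pow, Polynomial.aeval_X]
  rw [mul_div_assoc, div_self h, mul_one]

/-- `coordPow m` maps the box to the box. [folklore] -/
theorem coordPow_mem_ubox {m : ℕ} (hm : m ≠ 0) {x : Fin 3 → ℝ} (hx : x ∈ ubox) :
    BoxIntegral.coordPow m x ∈ ubox :=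
  BoxIntegral.mapsTo_coordPow_box hm hx

/-- **Monomial flattening**: `[box, c·tᵏ] ∼ [box, c/(k+1)³]` by ONE dilation `xᵢ ↦ xᵢ^{k+1}`
applied to the constant (Jacobian `(k+1)³ tᵏ`). [folklore] -/
theorem rel_monomial (c : ℚ) (k : ℕ) :
    Rel (C c * X ^ k * (1 - X ^ 2)) (C (c / ((k : ℚ) + 1) ^ 3) * (1 - X ^ 2)) := by
  refine KZ.changeOfVariablesRel_subset_relations
    (dilation_mem_changeOfVariablesRel (m := k + 1) (Nat.succ_ne_zero k) _ _ rfl rfl fun x hx => ?_)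
  rw [integrand_mul_one_sub_sq _ hx,
    integrand_mul_one_sub_sq _ (coordPow_mem_ubox (Nat.succ_ne_zero k) hx)]
  simp only [map_mul, Polynomial.aeval_C, map_pow, Polynomial.aeval_X, eq_ratCast,
    Nat.add_sub_cancel, Fin.prod_univ_three]
  push_cast
  have hk : ((k : ℝ) + 1) ≠ 0 := by positivity
  field_simp
  ring

/-- **The polar distribution relation** with a rational scalar: `[box, c/(1−t²)] ∼ [box, 7c·t/(1−t²)]`
(dilation `m = 2` on `c/(1−s) = c(1+s)/(1−s²)`, giving `[8c·t] − [c + c·t]`, plus two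
integrand additivities). [folklore] -/
theorem rel_polar (c : ℚ) : Rel (C c) (C (7 * c) * X) := by
  -- B: [8c t] − [c + c t] is one dilation
  have hB : Rel (C (8 * c) * X) (C c + C c * X) := by
    refine KZ.changeOfVariablesRel_subset_relations
      (dilation_mem_changeOfVariablesRel (m := 2) two_ne_zero _ _ rfl rfl fun x hx => ?_)
    have ht := prod_mem_Ioo hx
    have hsq : (x 0 * x 1 * x 2) ^ 2 < 1 := by nlinarith [ht.1, ht.2]
    have hA : (1 : ℝ) - (x 0 * x 1 * x 2) ^ 2 ≠ 0 := by linarith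
    have hB : (1 : ℝ) - (x 0 ^ 2 * x 1 ^ 2 * x 2 ^ 2) ^ 2 ≠ 0 := by
      have : (x 0 ^ 2 * x 1 ^ 2 * x 2 ^ 2) ^ 2 = ((x 0 * x 1 * x 2) ^ 2) ^ 2 := by ring
      rw [this]
      have h0 : 0 ≤ (x 0 * x 1 * x 2) ^ 2 := sq_nonneg _
      have hlt : ((x 0 * x 1 * x 2) ^ 2) ^ 2 < 1 := by nlinarith
      linarith
    simp only [sectorRep_integrand, BoxIntegral.coordPow_apply, Fin.prod_univ_three, map_mul,
      Polynomial.aeval_C, Polynomial.aeval_X, map_add, eq_ratCast]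
    push_cast
    rw [eq_comm, div_mul_eq_mul_div, div_eq_div_iff hB hA]
    ring
  -- A: [c + c t] − [c] − [c t];  C: [8c t] − [c t] − [7c t]
  have hA := of_add_sub_sub_mem (C c) (C c * X)
  have hC := of_add_sub_sub_mem (C c * X) (C (7 * c) * X)
  have he8 : sectorRep (C c * X + C (7 * c) * X) = sectorRep (C (8 * c) * X) := by
    congr 1
    simp only [map_mul]
    have h7 : (C (7 : ℚ)) = 7 := rfl
    have h8 : (C (8 : ℚ)) = 8 := rfl
    rw [h7, h8]; ring
  rw [he8] at hC
  have : KZ.of (sectorRep (C c)) - KZ.of (sectorRep (C (7 * c) * X)) =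
      -(KZ.of (sectorRep (C c + C c * X)) - KZ.of (sectorRep (C c)) - KZ.of (sectorRep (C c * X))) -
        (KZ.of (sectorRep (C (8 * c) * X)) - KZ.of (sectorRep (C c + C c * X))) +
        (KZ.of (sectorRep (C (8 * c) * X)) - KZ.of (sectorRep (C c * X)) -
          KZ.of (sectorRep (C (7 * c) * X))) := by
    abel
  show KZ.of (sectorRep (C c)) - KZ.of (sectorRep (C (7 * c) * X)) ∈ KZ.relations
  rw [this]
  exact KZ.relations.add_mem (KZ.relations.sub_mem (KZ.relations.neg_mem hA) hB) hC

/-! ### §7.3 The normal form `nf P = a·(1 − X²) + b·X` and the reduction `Rel P (nf P)` -/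

/-- The monic divisor `X² − 1`. [folklore] -/
def D : ℚ[X] := X ^ 2 - C 1

/-- Auxiliary: `monic_D`. [folklore] -/
theorem monic_D : D.Monic := Polynomial.monic_X_pow_sub_C (1 : ℚ) two_ne_zero

/-- Auxiliary: `degree_D`. [folklore] -/
theorem degree_D : D.degree = 2 := by
  unfold D
  compute_degree!

/-- The polynomial part `Q` of `P = Q·(1 − X²) + (α + βX)`. [folklore] -/
def quo (P : ℚ[X]) : ℚ[X] := -(P /ₘ D)

/-- The polar remainder `α + βX` of `P` (degree `≤ 1`). [folklore] -/
def rem (P : ℚ[X]) : ℚ[X] := P %ₘ D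

/-- Auxiliary: `degree_rem_le`. [folklore] -/
theorem degree_rem_le (P : ℚ[X]) : (rem P).degree ≤ 1 := by
  have h : (rem P).degree < 2 := by
    rw [← degree_D]
    exact Polynomial.degree_modByMonic_lt P monic_D
  have : (rem P).degree < (2 : ℕ) := h
  exact Order.le_of_lt_succ (by exact_mod_cast h)

/-- The decomposition `P = Σ_k C q_k · X^k · (1 − X²) + C α + C β · X`. [folklore] -/
theorem decomp (P : ℚ[X]) :
    P = (∑ k ∈ Finset.range ((quo P).natDegree + 1), C ((quo P).coeff k) * X ^ k * (1 - X ^ 2)) +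
      (C ((rem P).coeff 0) + C ((rem P).coeff 1) * X) := by
  have h1 : rem P + D * (P /ₘ D) = P := Polynomial.modByMonic_add_div P D
  have h2 : rem P = C ((rem P).coeff 1) * X + C ((rem P).coeff 0) :=
    Polynomial.eq_X_add_C_of_degree_le_one (degree_rem_le P)
  have h3 : quo P = ∑ k ∈ Finset.range ((quo P).natDegree + 1), C ((quo P).coeff k) * X ^ k :=
    Polynomial.as_sum_range_C_mul_X_pow (quo P)
  have h4 : (∑ k ∈ Finset.range ((quo P).natDegree + 1), C ((quo P).coeff k) * X ^ k * (1 - X ^ 2)) =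
      quo P * (1 - X ^ 2) := by
    rw [← Finset.sum_mul, ← h3]
  rw [h4]
  have hq : quo P * (1 - X ^ 2) = D * (P /ₘ D) := by
    unfold quo D
    simp only [map_one]
    ring
  rw [hq, add_comm (C _) (C _ * X), ← h2, add_comm, h1]

/-- The rational part `Σ q_k/(k+1)³` of the value. [folklore] -/
def qsum (P : ℚ[X]) : ℚ :=
  ∑ k ∈ Finset.range ((quo P).natDegree + 1), (quo P).coeff k / ((k : ℚ) + 1) ^ 3

/-- The `ζ(3)/8`-coefficient `7α + β` of the value. [folklore] -/
def lin (P : ℚ[X]) : ℚ := 7 * (rem P).coeff 0 + (rem P).coeff 1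

/-- **The normal form** `nf P = qsum P · (1 − X²) + lin P · X` (integrand `a + b·t/(1 − t²)`). [folklore] -/
def nf (P : ℚ[X]) : ℚ[X] := C (qsum P) * (1 - X ^ 2) + C (lin P) * X

/-- **Reduction**: every numerator is related to its normal form. [folklore] -/
theorem rel_nf (P : ℚ[X]) : Rel P (nf P) := by
  have hmono : Rel
      (∑ k ∈ Finset.range ((quo P).natDegree + 1), C ((quo P).coeff k) * X ^ k * (1 - X ^ 2))
      (∑ k ∈ Finset.range ((quo P).natDegree + 1),
        C ((quo P).coeff k / ((k : ℚ) + 1) ^ 3) * (1 - X ^ 2)) :=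
    Rel.sum _ _ _ fun k _ => rel_monomial _ k
  have hpol : Rel (C ((rem P).coeff 0) + C ((rem P).coeff 1) * X)
      (C (7 * (rem P).coeff 0) * X + C ((rem P).coeff 1) * X) :=
    (rel_polar _).add (Rel.refl _)
  have h := hmono.add hpol
  rw [← decomp P] at h
  refine h.trans (Rel.of_eq ?_)
  unfold nf qsum lin
  rw [← Finset.sum_mul, ← map_sum C]
  simp only [map_add, map_mul]
  ring

/-! ### §7.4 Values of normal forms and rigidity (Apéry) -/

/-- **Value of a normal form**: `∫_{(0,1)³} (a(1−t²) + b·t)/(1−t²) = a + b·ζ(3)/8`. [folklore] -/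
theorem value_nf (a b : ℚ) :
    (sectorRep (C a * (1 - X ^ 2) + C b * X)).value = a + b * (1 / 8 * zetaValue 3) := by
  have h1 := BoxIntegral.box_integral_level_two_weight_three_one
  have hconst : IntegrableOn (fun _ : Fin 3 → ℝ => (a : ℝ)) ubox volume :=
    BoxIntegral.integrableOn_box_const 3 a
  have hpol : IntegrableOn (fun x : Fin 3 → ℝ =>
      (b : ℝ) * ((x 0 * x 1 * x 2) ^ 1 / (1 - (x 0 * x 1 * x 2) ^ 2))) ubox volume :=
    h1.1.const_mul _
  have hsum : ∫ x in ubox, ((a : ℝ) + (b : ℝ) * ((x 0 * x 1 * x 2) ^ 1 / (1 - (x 0 * x 1 * x 2) ^ 2)))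
      = a + b * (1 / 8 * zetaValue 3) := by
    rw [integral_add hconst hpol, MeasureTheory.integral_const_mul]
    show (∫ _ in {x : Fin 3 → ℝ | ∀ i, x i ∈ Ioo (0:ℝ) 1}, (a : ℝ)) +
      (b : ℝ) * ∫ x in {x : Fin 3 → ℝ | ∀ i, x i ∈ Ioo (0:ℝ) 1},
        (x 0 * x 1 * x 2) ^ 1 / (1 - (x 0 * x 1 * x 2) ^ 2) = _
    rw [BoxIntegral.setIntegral_box_const, h1.2]
  rw [← hsum]
  show ∫ x in ubox, (sectorRep (C a * (1 - X ^ 2) + C b * X)).integrand x = _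
  refine setIntegral_congr_fun measurableSet_ubox fun x hx => ?_
  have h : (1 : ℝ) - x 0 ^ 2 * x 1 ^ 2 * x 2 ^ 2 ≠ 0 := by
    have h0 := (one_sub_sq_pos hx).ne'
    have : x 0 ^ 2 * x 1 ^ 2 * x 2 ^ 2 = (x 0 * x 1 * x 2) ^ 2 := by ring
    rwa [this]
  simp only [sectorRep_integrand, map_add, map_mul, Polynomial.aeval_C, map_sub, map_one, map_pow,
    Polynomial.aeval_X, eq_ratCast, pow_one]
  rw [mul_pow, mul_pow]
  field_simp

/-- **Rigidity** (Apéry, `ζ(3) ∉ ℚ`, via the tree's `BoxIntegral.normalForm_weight_three_coeff_eq`):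
normal forms with equal values are equal. [folklore] -/
theorem nf_eq_of_value_eq {P P' : ℚ[X]}
    (h : (sectorRep (nf P)).value = (sectorRep (nf P')).value) : nf P = nf P' := by
  unfold nf at h ⊢
  rw [value_nf, value_nf] at h
  have h' : ((qsum P : ℚ) : ℝ) + ((lin P / 8 : ℚ) : ℝ) * zetaValue 3 =
      ((qsum P' : ℚ) : ℝ) + ((lin P' / 8 : ℚ) : ℝ) * zetaValue 3 := by
    push_cast
    linarith
  obtain ⟨hq, hl⟩ := BoxIntegral.normalForm_weight_three_coeff_eq h'
  have hl' : lin P = lin P' := by linarith [hl]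
  rw [hq, hl']

/-! ### §7.5 The crux -/

/-- A member of the sector with numerator `P` differs from `sectorRep P` by a relation
(same domain, integrands agree on it). [folklore] -/
theorem of_sub_of_sectorRep_mem {r : KZ.IntegralRep 3} {P : ℚ[X]} (hd : r.domain = ubox)
    (hi : EqOn r.integrand
      (fun x => Polynomial.aeval (x 0 * x 1 * x 2) P / (1 - (x 0 * x 1 * x 2) ^ 2)) r.domain) :
    KZ.of r - KZ.of (sectorRep P) ∈ KZ.relations :=
  KZ.of_sub_of_mem_relations_of_eqOn (by rw [sectorRep_domain, hd]) hi

/-- **`AperySectorThreeTwo` holds**: Conjecture 1 on the weight-3, level-2 box sector,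
unconditionally (reduction by one dilation per monomial + the `m = 2` distribution relation;
rigidity by Apéry). [folklore] -/
theorem aperySectorThreeTwo : AperySectorThreeTwo := by
  intro r r' P P' hd hd' hi hi' hv
  have e1 := of_sub_of_sectorRep_mem hd hi
  have e1' := of_sub_of_sectorRep_mem hd' hi'
  have e2 : Rel P (nf P) := rel_nf P
  have e2' : Rel P' (nf P') := rel_nf P'
  have v1 : r.value = (sectorRep P).value := KZ.Equivalent.value_eq_holds e1
  have v1' : r'.value = (sectorRep P').value := KZ.Equivalent.value_eq_holds e1'
  have v2 : (sectorRep P).value = (sectorRep (nf P)).value := KZ.Equivalent.value_eq_holds e2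
  have v2' : (sectorRep P').value = (sectorRep (nf P')).value := KZ.Equivalent.value_eq_holds e2'
  have hnf : nf P = nf P' := nf_eq_of_value_eq (by rw [← v2, ← v1, hv, v1', v2'])
  have : KZ.of r - KZ.of r' = (KZ.of r - KZ.of (sectorRep P)) +
      (KZ.of (sectorRep P) - KZ.of (sectorRep (nf P))) -
      (KZ.of (sectorRep P') - KZ.of (sectorRep (nf P'))) -
      (KZ.of r' - KZ.of (sectorRep P')) := by
    rw [hnf]; abel
  show KZ.of r - KZ.of r' ∈ KZ.relations
  rw [this]
  exact KZ.relations.sub_mem (KZ.relations.sub_mem (KZ.relations.add_mem e1 e2) e2') e1'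


end Proof

end Summit.KontsevichZagierPeriods.KontsevichZagierPeriods.Cruxes.AperySectorThreeTwo.Disproof

end

/-! ## §8 Targets (cycle 2, 2026-08-16, gen-2 seat): every registered stub HOLDS — attack = proof

Re-armed at rearm level 2 (a line skeleton is registered on the item). Registered skeletons at
01:31Z (`ledger workitem get stmt-KontsevichZagierPeriods-3873 --json`, `.payload.stubs/.skeleton`;
three registrations in four minutes, each expiring the previous one):
* line `flattening-dilation` — ACTIVE skeleton `2cbf2400…`: `stub_monomialFlatten`,
  `stub_polarDistribution`, `stub_normalFormReduction`, `stub_normalFormRigidity`;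
* line `level-lowering` — skeleton `b197cf8f…` (expired 01:31Z): `stub_levelTwoToLevelOne`,
  `stub_polynomialCompression`;
* line `dilation-coinvariants` — skeleton `3ec24f12…` (expired 01:29Z): `stub_certificate`,
  `stub_polyCoboundary`, `stub_polarCoboundary` (they mention that skeleton's own `boxval`; proved
  verbatim by its planner, evidence `StubsProved-dilation-coinvariants.lean`, rc0/0 sorry — not
  restated here; mathematically `stub_polarCoboundary` = `Proof.rel_polar` + (1b) and
  `stub_polyCoboundary` = `Proof.rel_monomial` summed + (1b)).

VERDICT for the lead: **no registered stub is false, vacuous or mis-typed.** The six theorems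
below carry the registered signatures VERBATIM (only the `KZ.` / `Polynomial.` namespaces are
opened and `{x | ∀ i, x i ∈ Set.Ioo 0 1}` is this file's `ubox` definitionally) and each closes in
a few lines from §6–§7: the disprover's attack on every target IS its proof. Side conditions
checked on the way: `stub_monomialFlatten` needs BOTH domain clauses (the CoV instance pins
`r'.domain = Φ '' r.domain = box`); its orientation `[monomial] − [constant]` matches
`changeOfVariablesRel`'s `r.integrand x = r'.integrand (Φ x)·|det Φ'|` with `Φ = coordPow (k+1)`
(pull-back of the CONSTANT is the monomial, not conversely); `stub_polarDistribution` carries no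
value hypothesis and needs none (`h₀ = 7h₁` is a theorem); `stub_normalFormRigidity` is exactly
Apéry (`BoxIntegral.normalForm_weight_three_coeff_eq`) after `Proof.value_nf`, and its value
hypothesis is load-bearing (§2). Minimality remark (not claimed as a theorem): the polar target is
NOT a single coordinate dilation in either orientation (`c/(1−t²) ≠ 7c·m³t^{2m−1}/(1−t^{2m})` and
`7ct/(1−t²) ≠ c·m³t^{m−1}/(1−t^{2m})` for all `m ≥ 1` as rational functions), so inside the
sector the shortest known chain is §6's 1 CoV + 2 (1b); whether SOME non-product semialgebraic
`Φ` realises it in one move is a transport question of the `cressonViuSos_prop_3_2` type, open. -/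

noncomputable section

set_option linter.dupNamespace false

open MeasureTheory Set
open Polynomial
open Literature.NumberTheory.Transcendental Literature.ModelTheory.ExponentialFields

namespace Summit.KontsevichZagierPeriods.KontsevichZagierPeriods.Cruxes.AperySectorThreeTwo.Disproof

namespace Targets

/-! ### §8.1 Line `flattening-dilation` (active skeleton `2cbf2400…`) -/

/-- TARGET `stub_monomialFlatten` HOLDS (verbatim signature): `[box, c·tᵏ] − [box, c/(k+1)³]` is
ONE change-of-variables instance, the dilation `xᵢ ↦ xᵢ^{k+1}` of §6
(`dilation_mem_changeOfVariablesRel`). [folklore] -/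
theorem stub_monomialFlatten_holds :
    ∀ (c : ℚ) (k : ℕ) (r r' : KZ.IntegralRep 3), r.domain = {x | ∀ i, x i ∈ Set.Ioo (0:ℝ) 1} →
      r'.domain = {x | ∀ i, x i ∈ Set.Ioo (0:ℝ) 1} →
      Set.EqOn r.integrand (fun x => (c : ℝ) * (x 0 * x 1 * x 2) ^ k) r.domain →
      Set.EqOn r'.integrand (fun _ => (c : ℝ) / ((k : ℝ) + 1) ^ 3) r'.domain →
      KZ.of r - KZ.of r' ∈ KZ.changeOfVariablesRel := by
  intro c k r r' hd hd' hi hi'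
  refine dilation_mem_changeOfVariablesRel (m := k + 1) (Nat.succ_ne_zero k) r r' hd hd'
    fun x hx => ?_
  have hx' : x ∈ r.domain := by rw [hd]; exact hx
  have hΦ : BoxIntegral.coordPow (k + 1) x ∈ r'.domain := by
    rw [hd']; exact Proof.coordPow_mem_ubox (Nat.succ_ne_zero k) hx
  rw [hi hx', hi' hΦ]
  simp only [Nat.add_sub_cancel, Fin.prod_univ_three]
  push_cast
  have hk : ((k : ℝ) + 1) ≠ 0 := by positivity
  field_simp
  ring

/-- TARGET `stub_polarDistribution` HOLDS (verbatim signature): `[box, c/(1−t²)] ~ [box, 7c·t/(1−t²)]`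
by `Proof.rel_polar` (1 dilation + 2 integrand additivities) and congruence of the two given reps
with the canonical `sectorRep`s. [folklore] -/
theorem stub_polarDistribution_holds :
    ∀ (c : ℚ) (r r' : KZ.IntegralRep 3), r.domain = {x | ∀ i, x i ∈ Set.Ioo (0:ℝ) 1} →
      r'.domain = {x | ∀ i, x i ∈ Set.Ioo (0:ℝ) 1} →
      Set.EqOn r.integrand (fun x => (c : ℝ) / (1 - (x 0 * x 1 * x 2) ^ 2)) r.domain →
      Set.EqOn r'.integrand
        (fun x => 7 * (c : ℝ) * (x 0 * x 1 * x 2) / (1 - (x 0 * x 1 * x 2) ^ 2)) r'.domain →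
      KZ.Equivalent r r' := by
  intro c r r' hd hd' hi hi'
  have e1 : KZ.of r - KZ.of (sectorRep (C c)) ∈ KZ.relations :=
    KZ.of_sub_of_mem_relations_of_eqOn (by rw [sectorRep_domain, hd]; rfl) fun x hx => by
      rw [hi hx]
      simp
  have e2 : KZ.of r' - KZ.of (sectorRep (C (7 * c) * X)) ∈ KZ.relations :=
    KZ.of_sub_of_mem_relations_of_eqOn (by rw [sectorRep_domain, hd']; rfl) fun x hx => by
      rw [hi' hx]
      simp only [sectorRep_integrand, map_mul, Polynomial.aeval_C, Polynomial.aeval_X, eq_ratCast]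
      push_cast
      ring
  have e3 : Proof.Rel (C c) (C (7 * c) * X) := Proof.rel_polar c
  have : KZ.of r - KZ.of r' = (KZ.of r - KZ.of (sectorRep (C c))) +
      (KZ.of (sectorRep (C c)) - KZ.of (sectorRep (C (7 * c) * X))) -
      (KZ.of r' - KZ.of (sectorRep (C (7 * c) * X))) := by abel
  show KZ.of r - KZ.of r' ∈ KZ.relations
  rw [this]
  exact KZ.relations.sub_mem (KZ.relations.add_mem e1 e3) e2

/-- On the box the normal form `nf`-shaped numerator `a(1 − X²) + bX` has integrand
`a + b·t/(1 − t²)`. [folklore] -/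
theorem sectorRep_nf_integrand (a b : ℚ) {x : Fin 3 → ℝ} (hx : x ∈ ubox) :
    (sectorRep (C a * (1 - X ^ 2) + C b * X)).integrand x =
      (a : ℝ) + (b : ℝ) * (x 0 * x 1 * x 2) / (1 - (x 0 * x 1 * x 2) ^ 2) := by
  have h := (one_sub_sq_pos hx).ne'
  simp only [sectorRep_integrand, map_add, map_mul, map_sub, map_one, map_pow, Polynomial.aeval_C,
    Polynomial.aeval_X, eq_ratCast]
  rw [add_div, mul_div_assoc, div_self h, mul_one]

/-- TARGET `stub_normalFormReduction` HOLDS (verbatim signature; its two antecedents are not even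
needed): every member reduces to `[box, a + b·t/(1−t²)]` with `a = Proof.qsum P`,
`b = Proof.lin P`, by `Proof.rel_nf`. [folklore] -/
theorem stub_normalFormReduction_holds :
    (∀ (c : ℚ) (k : ℕ) (r r' : KZ.IntegralRep 3), r.domain = {x | ∀ i, x i ∈ Set.Ioo (0:ℝ) 1} →
      r'.domain = {x | ∀ i, x i ∈ Set.Ioo (0:ℝ) 1} →
      Set.EqOn r.integrand (fun x => (c : ℝ) * (x 0 * x 1 * x 2) ^ k) r.domain →
      Set.EqOn r'.integrand (fun _ => (c : ℝ) / ((k : ℝ) + 1) ^ 3) r'.domain →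
      KZ.of r - KZ.of r' ∈ KZ.changeOfVariablesRel) →
    (∀ (c : ℚ) (r r' : KZ.IntegralRep 3), r.domain = {x | ∀ i, x i ∈ Set.Ioo (0:ℝ) 1} →
      r'.domain = {x | ∀ i, x i ∈ Set.Ioo (0:ℝ) 1} →
      Set.EqOn r.integrand (fun x => (c : ℝ) / (1 - (x 0 * x 1 * x 2) ^ 2)) r.domain →
      Set.EqOn r'.integrand
        (fun x => 7 * (c : ℝ) * (x 0 * x 1 * x 2) / (1 - (x 0 * x 1 * x 2) ^ 2)) r'.domain →
      KZ.Equivalent r r') →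
    ∀ (P : Polynomial ℚ) (r : KZ.IntegralRep 3), r.domain = {x | ∀ i, x i ∈ Set.Ioo (0:ℝ) 1} →
      Set.EqOn r.integrand
        (fun x => Polynomial.aeval (x 0 * x 1 * x 2) P / (1 - (x 0 * x 1 * x 2) ^ 2)) r.domain →
      ∃ (a b : ℚ) (r' : KZ.IntegralRep 3), r'.domain = {x | ∀ i, x i ∈ Set.Ioo (0:ℝ) 1} ∧
        Set.EqOn r'.integrand
          (fun x => (a : ℝ) + (b : ℝ) * (x 0 * x 1 * x 2) / (1 - (x 0 * x 1 * x 2) ^ 2)) r'.domain ∧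
        KZ.Equivalent r r' := by
  intro _ _ P r hd hi
  refine ⟨Proof.qsum P, Proof.lin P, sectorRep (Proof.nf P), rfl,
    fun x hx => sectorRep_nf_integrand _ _ hx, ?_⟩
  have e1 := Proof.of_sub_of_sectorRep_mem hd hi
  have e2 : Proof.Rel P (Proof.nf P) := Proof.rel_nf P
  have : KZ.of r - KZ.of (sectorRep (Proof.nf P)) =
      (KZ.of r - KZ.of (sectorRep P)) + (KZ.of (sectorRep P) - KZ.of (sectorRep (Proof.nf P))) := by
    abel
  show KZ.of r - KZ.of (sectorRep (Proof.nf P)) ∈ KZ.relations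
  rw [this]
  exact KZ.relations.add_mem e1 e2

/-- TARGET `stub_normalFormRigidity` HOLDS (verbatim signature): `Proof.value_nf` + Apéry
(`BoxIntegral.normalForm_weight_three_coeff_eq`). Its value hypothesis is load-bearing (§2). [folklore] -/
theorem stub_normalFormRigidity_holds :
    ∀ (a b a' b' : ℚ) (r r' : KZ.IntegralRep 3), r.domain = {x | ∀ i, x i ∈ Set.Ioo (0:ℝ) 1} →
      Set.EqOn r.integrand
        (fun x => (a : ℝ) + (b : ℝ) * (x 0 * x 1 * x 2) / (1 - (x 0 * x 1 * x 2) ^ 2)) r.domain →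
      r'.domain = {x | ∀ i, x i ∈ Set.Ioo (0:ℝ) 1} →
      Set.EqOn r'.integrand
        (fun x => (a' : ℝ) + (b' : ℝ) * (x 0 * x 1 * x 2) / (1 - (x 0 * x 1 * x 2) ^ 2)) r'.domain →
      r.value = r'.value → a = a' ∧ b = b' := by
  intro a b a' b' r r' hd hi hd' hi' hv
  have e : KZ.of r - KZ.of (sectorRep (C a * (1 - X ^ 2) + C b * X)) ∈ KZ.relations :=
    KZ.of_sub_of_mem_relations_of_eqOn (by rw [sectorRep_domain, hd]; rfl) fun x hx => by
      rw [hi hx, sectorRep_nf_integrand a b (by rw [hd] at hx; exact hx)]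
  have e' : KZ.of r' - KZ.of (sectorRep (C a' * (1 - X ^ 2) + C b' * X)) ∈ KZ.relations :=
    KZ.of_sub_of_mem_relations_of_eqOn (by rw [sectorRep_domain, hd']; rfl) fun x hx => by
      rw [hi' hx, sectorRep_nf_integrand a' b' (by rw [hd'] at hx; exact hx)]
  have v := KZ.Equivalent.value_eq_holds e
  have v' := KZ.Equivalent.value_eq_holds e'
  rw [Proof.value_nf] at v
  rw [Proof.value_nf] at v'
  have h : ((a : ℚ) : ℝ) + ((b / 8 : ℚ) : ℝ) * zetaValue 3 =
      ((a' : ℚ) : ℝ) + ((b' / 8 : ℚ) : ℝ) * zetaValue 3 := by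
    push_cast
    linarith
  obtain ⟨ha, hb⟩ := BoxIntegral.normalForm_weight_three_coeff_eq h
  exact ⟨ha, by linarith [hb]⟩

/-! ### §8.2 Line `level-lowering` (skeleton `b197cf8f…`, expired but re-registrable) -/

/-- TARGET `stub_levelTwoToLevelOne` HOLDS (verbatim signature): every level-2 member is
KZ-equivalent to a level-1 member `[box, P₁(t)/(1−t)]`, with
`P₁ = qsum P·(1 − X) + lin P/8` (so `P₁(1+X) = qsum P·(1−X²) + lin P/8 + (lin P/8)·X ∼ nf P`
by `rel_polar (lin P/8)` backwards). [folklore] -/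
theorem stub_levelTwoToLevelOne_holds :
    ∀ (r : KZ.IntegralRep 3) (P : Polynomial ℚ), r.domain = {x | ∀ i, x i ∈ Set.Ioo (0:ℝ) 1} →
      Set.EqOn r.integrand
        (fun x => Polynomial.aeval (x 0 * x 1 * x 2) P / (1 - (x 0 * x 1 * x 2) ^ 2)) r.domain →
      ∃ (P₁ : Polynomial ℚ) (r₁ : KZ.IntegralRep 3), r₁.domain = {x | ∀ i, x i ∈ Set.Ioo (0:ℝ) 1} ∧
        Set.EqOn r₁.integrand
          (fun x => Polynomial.aeval (x 0 * x 1 * x 2) P₁ / (1 - x 0 * x 1 * x 2)) r₁.domain ∧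
        KZ.Equivalent r r₁ := by
  intro r P hd hi
  set P₁ : ℚ[X] := C (Proof.qsum P) * (1 - X) + C (Proof.lin P / 8) with hP₁
  refine ⟨P₁, sectorRep (P₁ * (1 + X)), rfl, ?_, ?_⟩
  · intro x hx
    have ht := prod_mem_Ioo hx
    have h1 : (1 : ℝ) - x 0 * x 1 * x 2 ≠ 0 := by linarith [ht.2]
    have h2 : (1 : ℝ) + x 0 * x 1 * x 2 ≠ 0 := by linarith [ht.1]
    have h3 := (one_sub_sq_pos hx).ne'
    simp only [sectorRep_integrand, map_mul, map_add, map_one, Polynomial.aeval_X]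
    rw [div_eq_div_iff h3 h1]
    ring
  · have e1 := Proof.of_sub_of_sectorRep_mem hd hi
    have e2 : Proof.Rel P (Proof.nf P) := Proof.rel_nf P
    -- nf P = qsum·(1−X²) + lin·X  ∼  qsum·(1−X²) + lin/8 + (lin/8)·X = P₁ (1 + X)
    have hsplit : C (Proof.lin P) * X = C (7 * (Proof.lin P / 8)) * X + C (Proof.lin P / 8) * X := by
      rw [← add_mul, ← C_add]
      congr 2
      ring
    have e3 : Proof.Rel (C (Proof.lin P) * X) (C (Proof.lin P / 8) + C (Proof.lin P / 8) * X) := by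
      rw [hsplit]
      exact (Proof.rel_polar (Proof.lin P / 8)).symm.add (Proof.Rel.refl _)
    have e4 : Proof.Rel (Proof.nf P) (P₁ * (1 + X)) := by
      have h := (Proof.Rel.refl (C (Proof.qsum P) * (1 - X ^ 2))).add e3
      refine h.trans (Proof.Rel.of_eq ?_)
      rw [hP₁]
      ring
    have : KZ.of r - KZ.of (sectorRep (P₁ * (1 + X))) =
        (KZ.of r - KZ.of (sectorRep P)) + (KZ.of (sectorRep P) - KZ.of (sectorRep (Proof.nf P))) +
        (KZ.of (sectorRep (Proof.nf P)) - KZ.of (sectorRep (P₁ * (1 + X)))) := by abel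
    show KZ.of r - KZ.of (sectorRep (P₁ * (1 + X))) ∈ KZ.relations
    rw [this]
    exact KZ.relations.add_mem (KZ.relations.add_mem e1 e2) e4

/-- TARGET `stub_polynomialCompression` HOLDS (verbatim signature): `[box, Q(t)] ~ [box, a]` with
`a = Σ_k q_k/(k+1)³`, one flattening dilation per monomial (`Proof.rel_monomial`) summed by (1b). [folklore] -/
theorem stub_polynomialCompression_holds :
    ∀ (r : KZ.IntegralRep 3) (Q : Polynomial ℚ), r.domain = {x | ∀ i, x i ∈ Set.Ioo (0:ℝ) 1} →
      Set.EqOn r.integrand (fun x => Polynomial.aeval (x 0 * x 1 * x 2) Q) r.domain →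
      ∃ (a : ℚ) (r' : KZ.IntegralRep 3), r'.domain = {x | ∀ i, x i ∈ Set.Ioo (0:ℝ) 1} ∧
        Set.EqOn r'.integrand (fun _ => (a : ℝ)) r'.domain ∧ KZ.Equivalent r r' := by
  intro r Q hd hi
  set a : ℚ := ∑ k ∈ Finset.range (Q.natDegree + 1), Q.coeff k / ((k : ℚ) + 1) ^ 3 with ha
  refine ⟨a, sectorRep (C a * (1 - X ^ 2)), rfl, ?_, ?_⟩
  · intro x hx
    rw [Proof.integrand_mul_one_sub_sq _ hx]
    simp
  · have e1 : KZ.of r - KZ.of (sectorRep (Q * (1 - X ^ 2))) ∈ KZ.relations :=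
      KZ.of_sub_of_mem_relations_of_eqOn (by rw [sectorRep_domain, hd]; rfl) fun x hx => by
        rw [hi hx, Proof.integrand_mul_one_sub_sq Q (by rw [hd] at hx; exact hx)]
    have hmono : Proof.Rel
        (∑ k ∈ Finset.range (Q.natDegree + 1), C (Q.coeff k) * X ^ k * (1 - X ^ 2))
        (∑ k ∈ Finset.range (Q.natDegree + 1), C (Q.coeff k / ((k : ℚ) + 1) ^ 3) * (1 - X ^ 2)) :=
      Proof.Rel.sum _ _ _ fun k _ => Proof.rel_monomial _ k
    have hQ : Q * (1 - X ^ 2) =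
        ∑ k ∈ Finset.range (Q.natDegree + 1), C (Q.coeff k) * X ^ k * (1 - X ^ 2) := by
      rw [← Finset.sum_mul, ← Polynomial.as_sum_range_C_mul_X_pow Q]
    have hA : (∑ k ∈ Finset.range (Q.natDegree + 1), C (Q.coeff k / ((k : ℚ) + 1) ^ 3) * (1 - X ^ 2)) =
        C a * (1 - X ^ 2) := by
      rw [← Finset.sum_mul, ← map_sum C, ha]
    have e2 : Proof.Rel (Q * (1 - X ^ 2)) (C a * (1 - X ^ 2)) := by
      rw [hQ, ← hA]; exact hmono
    have : KZ.of r - KZ.of (sectorRep (C a * (1 - X ^ 2))) =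
        (KZ.of r - KZ.of (sectorRep (Q * (1 - X ^ 2)))) +
        (KZ.of (sectorRep (Q * (1 - X ^ 2))) - KZ.of (sectorRep (C a * (1 - X ^ 2)))) := by abel
    show KZ.of r - KZ.of (sectorRep (C a * (1 - X ^ 2))) ∈ KZ.relations
    rw [this]
    exact KZ.relations.add_mem e1 e2

/-! ### §8.3 Refuted shortening of the polar target: NOT one `m = 2` dilation (either orientation)

The natural guess "the distribution relation `h₀ = 7h₁` IS the `m = 2` dilation, so
`stub_polarDistribution` is a single `changeOfVariablesRel` instance with `Φ = Φ₂ = (xᵢ²)ᵢ`" is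
FALSE at the level of the move's integrand condition `f x = f' (Φ x)·|det Φ'(x)|`: pulling
`7c·s/(1−s²)` back along `Φ₂` gives `56c·t³/(1−t⁴)`, pulling `c/(1−s²)` back gives
`8c·t/(1−t⁴)` — neither is the other member (test point `x = (½,½,½)`, `t = 1/8`). What `Φ₂`
does realise is `[8c·t/(1−t²)] − [c(1+t)/(1−t²)]` (§6 `polar_dilation_mem_changeOfVariablesRel`),
whence the chain 1 CoV + 2 (1b). (For every `m ≥ 1` the same test point works:
`7m³8^{1−2m}·(63/64)/(1−8^{−2m}) < 1`; only `m = 2` is machine-checked here.) -/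

/-- The test point `(½,½,½)` of the open box. [folklore] -/
theorem half_mem_ubox : (fun _ => (2⁻¹ : ℝ) : Fin 3 → ℝ) ∈ ubox := fun _ => by norm_num

/-- REFUTED SHORTENING (orientation A): with source `[box, c/(1−t²)]` and target
`[box, 7c·t/(1−t²)]`, the `Φ₂`-pull-back identity required by `changeOfVariablesRel` fails
(unless `c = 0`). [folklore] -/
theorem polar_not_dilationTwo_pullback {c : ℚ} (hc : c ≠ 0) (r r' : KZ.IntegralRep 3)
    (hd : r.domain = ubox) (hd' : r'.domain = ubox)
    (hi : EqOn r.integrand (fun x => (c : ℝ) / (1 - (x 0 * x 1 * x 2) ^ 2)) r.domain)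
    (hi' : EqOn r'.integrand
      (fun x => 7 * (c : ℝ) * (x 0 * x 1 * x 2) / (1 - (x 0 * x 1 * x 2) ^ 2)) r'.domain) :
    ¬ ∀ x ∈ r.domain, r.integrand x =
        r'.integrand (BoxIntegral.coordPow 2 x) * |(BoxIntegral.coordPowDeriv 2 x).det| := by
  intro h
  have hxd : (fun _ => (2⁻¹ : ℝ) : Fin 3 → ℝ) ∈ r.domain := by rw [hd]; exact half_mem_ubox
  have hΦ : BoxIntegral.coordPow 2 (fun _ => (2⁻¹ : ℝ) : Fin 3 → ℝ) ∈ r'.domain := by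
    rw [hd']; exact Proof.coordPow_mem_ubox two_ne_zero half_mem_ubox
  have e := h _ hxd
  rw [hi hxd, hi' hΦ, BoxIntegral.abs_det_coordPowDeriv two_ne_zero half_mem_ubox] at e
  simp only [BoxIntegral.coordPow_apply, Fin.prod_univ_three] at e
  norm_num at e
  have hc0 : (c : ℝ) = 0 := by linarith
  exact hc (by exact_mod_cast hc0)

/-- REFUTED SHORTENING (orientation B): with source `[box, 7c·t/(1−t²)]` and target
`[box, c/(1−t²)]`, the `Φ₂`-pull-back identity fails as well (unless `c = 0`). [folklore] -/
theorem polar_not_dilationTwo_pushforward {c : ℚ} (hc : c ≠ 0) (r r' : KZ.IntegralRep 3)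
    (hd : r.domain = ubox) (hd' : r'.domain = ubox)
    (hi : EqOn r.integrand (fun x => (c : ℝ) / (1 - (x 0 * x 1 * x 2) ^ 2)) r.domain)
    (hi' : EqOn r'.integrand
      (fun x => 7 * (c : ℝ) * (x 0 * x 1 * x 2) / (1 - (x 0 * x 1 * x 2) ^ 2)) r'.domain) :
    ¬ ∀ x ∈ r'.domain, r'.integrand x =
        r.integrand (BoxIntegral.coordPow 2 x) * |(BoxIntegral.coordPowDeriv 2 x).det| := by
  intro h
  have hxd : (fun _ => (2⁻¹ : ℝ) : Fin 3 → ℝ) ∈ r'.domain := by rw [hd']; exact half_mem_ubox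
  have hΦ : BoxIntegral.coordPow 2 (fun _ => (2⁻¹ : ℝ) : Fin 3 → ℝ) ∈ r.domain := by
    rw [hd]; exact Proof.coordPow_mem_ubox two_ne_zero half_mem_ubox
  have e := h _ hxd
  rw [hi' hxd, hi hΦ, BoxIntegral.abs_det_coordPowDeriv two_ne_zero half_mem_ubox] at e
  simp only [BoxIntegral.coordPow_apply, Fin.prod_univ_three] at e
  norm_num at e
  have hc0 : (c : ℝ) = 0 := by linarith
  exact hc (by exact_mod_cast hc0)

end Targets

end Summit.KontsevichZagierPeriods.KontsevichZagierPeriods.Cruxes.AperySectorThreeTwo.Disproof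

end
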